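import Literature.NumberTheory.EllipticCurves.GrossPointsAtkinLehnerRamified
import Literature.NumberTheory.Automorphic.EichlerOrderAtkinLehnerIdeal
import HarnessLib

/-!
# The Atkin–Lehner involutions `W_{l⁺}` (`l ∣ N⁺`) on Gross points and the simply transitive action of
`Pic(𝒪_c) × W` on `H_N(K; c)` for a general type `(N⁺, N⁻)` (Bertolini–Darmon 1996, §2.3, proof of Lemma 2.5)

Topic `NumberTheory/EllipticCurves`, sequel of `GrossPointsAtkinLehnerRamified.lean` (the involutions
`W_{q⁻}`, `q ∣ N⁻`, their products `W⁻_T`, and the simply transitive action of `Pic(𝒪_c) × W⁻` for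
`N⁺ = 1`) and of `Literature/NumberTheory/Automorphic/EichlerOrderAtkinLehnerIdeal.lean` (the two-sided
Atkin–Lehner ideal `𝔔_m = atkinLehnerIdeal O m` of an Eichler order, its local structure at a level prime
`l^e ∥ N⁺` — `𝔔_l = w O_l`, `I 𝔔 𝔔 = l^e I` — and the "no-commute" lemma
`AtkinLehner.norm_disc_lt_one_of_commute`). Namespaces `Literature.NumberTheory.EllipticCurves.GrossSpace`
(§1, §3) and `Literature.NumberTheory.EllipticCurves.GrossPointsAtkinLehner` (§2, §4, §5). Two definitions
(`GrossSpace.atkinLehnerPlus`, `GrossSpace.atkinLehnerPlusList`) and theorems; no named fact, no `sorry`,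
no instance.

Bertolini–Darmon, *Heegner points on Mumford–Tate curves*, Invent. Math. 126 (1996). §1.5 (p. 422):
*"the standard involution … gives rise in a natural way to an involution on `X_{N⁺,N⁻}` which we call
`W_{p⁺}`"*; §2.3, proof of Lemma 2.5 (p. 431): *"let `W` be the Atkin–Lehner group `⟨W_{l⁺}, W_{l⁻}⟩` of
order `2^t` generated by all the Atkin–Lehner involutions `W_{l⁺}` with `l | N⁺` and `W_{l⁻}` with
`l | N⁻`. One can see by a direct calculation that the involution `W_{l⁺}` or `W_{l⁻}` sends a Heegner
point `P` to one with the opposite orientation at `l`, (and the same orientation at all the other primes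
dividing `N`). In fact, it can be shown (cf. [Vi], or [Gr2]) that the group `Pic(O) × W` acts simply
transitively on the set `H_N(K; c)` of Heegner points, and that the orbits of Heegner points under the
action of `Pic(O)` correspond exactly to sets of Heegner points with a given orientation."* Lemma 2.4:
*"The action of `Pic(O)` preserves the orientations"*.

In the tree's ideal-theoretic model of `H_N(K; c)` (`GrossPoints.lean`, `GrossSpace S.D K = Dˣ \ {(f, I)}`,
`[𝔞] • [(f, I)] = [(f, f(𝔞) I)]`) the involution at a level prime `l`, `l^e ∥ N⁺`, is right
multiplication of the ideal by the two-sided ideal `𝔔_{l^e}` of the Eichler order `O = S.O`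
(Vignéras II §2: locally `O_l = (ℤ_l ℤ_l; l^e ℤ_l ℤ_l)`, normaliser generated by `w = (0 1; l^e 0)`,
`𝔔_l = O_l w`, `w² = l^e`): **`W_{l⁺} [(f, I)] = [(f, I 𝔔_{l^e})]`** (§1). Orientations are not formalised
in the tree; the off-orbit statement "`W_{l⁺} P` has the opposite orientation at `l`, so is not in
`Pic(O) • P`" is proved directly (§2, `picard_smul_mk_ne_mk_of_localAt_eq_level`): an equality
`[𝔞] • [(f, I)] = [(f, I 𝔔)]` would produce, through the two orientation characters
`X ↦ X₀₀, X₁₁ (mod l)` of the level-`l^e` order `O_l` (which are multiplicative) applied to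
`f(𝔞) f(𝔞⁻¹) ∋ 1`, an Atkin–Lehner generator `u` of `𝔔_l` commuting with a conjugate `γ'` of the
generator `γ_c` of `f(𝒪_c)`, whose discriminant `c² d_K` is an `l`-adic unit — impossible
(`norm_disc_lt_one_of_commute`: reducing `u γ' = γ' u` mod `l` forces `tr(γ')² − 4 nrd(γ') ≡ 0`). This needs
only `l ∤ c d_K`, not the splitting of `l` in `K`.

## Contents

* §1 `GrossSpace.atkinLehnerPlus S l = mulRight 𝔔_{l^e}` (`e = v_l(N⁺)`): maps `H(c)` to `H(c)`
  (`O_L(I 𝔔) = O_L(I)`), is an involution on `H(c)` (`I 𝔔 𝔔 = l^e I`), commutes with `Pic(𝒪_c)`, with the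
  other `W_{l'⁺}` and with the `W_{q⁻}`.
* §2 the off-orbit theorem at a level prime: `σ • x ≠ W_{l⁺} x` (`l ∣ N⁺`, `l ∤ N⁻ c d_K`), and
  `Pic(𝒪_c) × ⟨W_{l⁺}⟩` acts freely (`picard_atkinLehnerPlus_injective`).
* §3 products `W⁺_{ls} = GrossSpace.atkinLehnerPlusList S ls`: independence of the order, `W_{l⁺}² = 1`
  inside words, reduction to square-free words, commutation with the minus-words `W⁻_{lm}` of the
  ramified file.
* §4 local data of `I ∏𝔓_q ∏𝔔_l` at a level prime and the off-orbit theorem for mixed words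
  `W⁺_{ls} W⁻_{lm}` with `ls ≠ ∅`.
* §5 **`Pic(𝒪_c) × W⁺ × W⁻` acts freely on `H_N(K; c)`** (`picard_atkinLehnerSets_injective`, `K`
  quadratic, `gcd(N⁺, N⁻) = 1`, `N⁺N⁻` prime to `c d_K`, primes of `N⁻` inert) and **simply transitively**
  for `K` imaginary quadratic, `N⁺N⁻` square-free, primes of `N⁺` split (`picard_atkinLehnerSets_bijective`,
  by counting with BD96 Lemma 2.5 (1), tree `natCard_grossPoints_eq_two_pow_mul_natCard_classGroup`).

## References

* [BertoliniDarmon1996] M. Bertolini, H. Darmon, *Heegner points on Mumford–Tate curves*, Invent. Math.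
  126 (1996), 413–456, §1.1, §1.5, §2.2–§2.3 (Lemmas 2.4, 2.5 and the proof of Lemma 2.5).
* [VignerasLNM800] M.-F. Vignéras, *Arithmétique des algèbres de quaternions*, LNM 800 (1980), Ch. II §2
  (ordres d'Eichler, normalisateur), Ch. III §5.
-/

noncomputable section

open scoped Pointwise nonZeroDivisors
open NumberField Module IsDedekindDomain
open Literature.NumberTheory.QuadraticFields.Quadratic
open Literature.NumberTheory.Automorphic
open Literature.NumberTheory.Automorphic.AtkinLehner

universe u

namespace Literature.NumberTheory.EllipticCurves

/-! ### §1 The involution `W_{l⁺}` at a prime `l ∣ N⁺` -/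

namespace GrossSpace

variable {K : Type u} [Field K] [NumberField K] {Nplus Nminus : ℕ}

/-- **The Atkin–Lehner involution `W_{l⁺}`** of the Gross space of a Brandt setup `S` of type
`(N⁺, N⁻)` at a prime `l` (of interest for `l ∣ N⁺`, `l^e ∥ N⁺`): `[(f, I)] ↦ [(f, I 𝔔_{l^e})]` with
`𝔔_{l^e} = atkinLehnerIdeal S.O (l^e)` the two-sided Atkin–Lehner ideal of the Eichler order (locally
`O_l w_l`, `w_l = (0 1; l^e 0)`; Bertolini–Darmon 1996 §1.5: "the standard involution `g ↦ (0 1; p 0) g`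
… gives rise in a natural way to an involution on `X_{N⁺,N⁻}` which we call `W_{p⁺}`"). For `l ∤ N⁺`
(`e = 0`) it is the identity on Heegner points (`𝔔_1 = O`). [cite: BertoliniDarmon1996, §1.5 (the Atkin–Lehner involutions W_{p⁺}) and §2.3 Lemma 2.5 (proof)] -/
def atkinLehnerPlus (S : Brandt.XiSetup Nplus Nminus) (l : ℕ) : GrossSpace S.D K → GrossSpace S.D K :=
  mulRight (atkinLehnerIdeal S.O (l ^ Nplus.factorization l))

/-- `W_{l⁺} [(f, I)] = [(f, I 𝔔_{l^e})]`. [cite: BertoliniDarmon1996, §1.5 and §2.3 Lemma 2.5 (proof)] -/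
@[simp] theorem atkinLehnerPlus_mk (S : Brandt.XiSetup Nplus Nminus) (l : ℕ) (r : GrossRep S.D K) :
    atkinLehnerPlus S l (mk r) = mk (GrossRep.mulRight (atkinLehnerIdeal S.O (l ^ Nplus.factorization l)) r) :=
  rfl

section Heegner

variable (S : Brandt.XiSetup Nplus Nminus) {l : ℕ} [hl : Fact l.Prime]

/-- The algebra of a Brandt setup is a division algebra. [folklore] -/
private theorem isUnit_of_ne_zero : ∀ x : S.D, x ≠ 0 → IsUnit x := fun _ hx =>
  isUnit_of_isTotallyDefinite S.D S.isTotallyDefinite hx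

/-- `O_L(I) ⊆ O_L(I P)` for any lattices. [folklore] -/
private theorem leftOrder_le_leftOrder_mul_right (I P : Submodule ℤ S.D) :
    Brandt.leftOrder I ≤ Brandt.leftOrder (I * P) := by
  intro x hx z hz
  refine Submodule.mul_induction_on hz (fun y hy w hw => ?_) (fun a b ha hb => ?_)
  · rw [← mul_assoc]
    exact Submodule.mul_mem_mul (hx y hy) hw
  · rw [mul_add]
    exact Submodule.add_mem _ ha hb

/-- **`O_L(I 𝔔_{l^e}) = O_L(I)`** for an invertible right `O`-ideal `I` (`𝔔` two-sided with
`I 𝔔 𝔔 = l^e I`), `l ∤ N⁻`. [cite: VignerasLNM800, Ch. II §2 (normalisateur), Ch. III §5] -/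
theorem leftOrder_mul_atkinLehnerIdeal (hlm : ¬ l ∣ Nminus) {I : Submodule ℤ S.D}
    (hI : IsInvertibleRightIdeal S.O I) :
    Brandt.leftOrder (I * atkinLehnerIdeal S.O (l ^ Nplus.factorization l)) = Brandt.leftOrder I := by
  haveI : IsAddTorsionFree S.D := S.isAddTorsionFree
  have hO : IsZOrder S.O := S.toEichlerPackage.isEichlerOrder.isZOrder
  obtain ⟨Φ, hΦ⟩ := S.exists_isLevelShape_iff S.nplus_ne_zero hlm
  have hPP := mul_atkinLehnerIdeal_mul_atkinLehnerIdeal Φ hO hΦ (isUnit_of_ne_zero S) hI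
  set m : ℕ := l ^ Nplus.factorization l with hm
  refine le_antisymm (fun x hx => ?_) (leftOrder_le_leftOrder_mul_right S I _)
  have hx2 : x ∈ Brandt.leftOrder (I * atkinLehnerIdeal S.O m * atkinLehnerIdeal S.O m) :=
    leftOrder_le_leftOrder_mul_right S _ _ hx
  rw [hPP] at hx2
  intro y hy
  have h := hx2 (((m : ℕ) : ℤ) • y) (Submodule.smul_mem_pointwise_smul y _ I hy)
  rw [mul_smul_comm] at h
  obtain ⟨z, hz, hzq⟩ := (Submodule.mem_smul_pointwise_iff_exists _ _ I).mp h
  have hm0 : ((m : ℕ) : ℤ) ≠ 0 := by exact_mod_cast pow_ne_zero _ hl.out.ne_zero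
  have : x * y = z := (smul_right_injective S.D hm0) (by simpa using hzq.symm)
  rw [this]; exact hz

/-- **`W_{l⁺}` preserves the Heegner representatives of conductor `c`**: `I 𝔔_{l^e}` is again an
invertible right `O`-ideal with the same left order, so `f` stays optimal. [cite: BertoliniDarmon1996, §2.3 Lemma 2.4–2.5] -/
theorem _root_.Literature.NumberTheory.EllipticCurves.GrossRep.IsHeegner.mulRight_atkinLehnerIdeal
    (hlm : ¬ l ∣ Nminus) {c : ℕ} {r : GrossRep S.D K} (hr : r.IsHeegner S.O c) :
    (GrossRep.mulRight (atkinLehnerIdeal S.O (l ^ Nplus.factorization l)) r).IsHeegner S.O c := by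
  haveI : Nontrivial S.D := Brandt.nontrivial_of_isQuaternionAlgebra
  haveI : IsAddTorsionFree S.D := S.isAddTorsionFree
  have hO : IsZOrder S.O := S.toEichlerPackage.isEichlerOrder.isZOrder
  have hI : IsInvertibleRightIdeal S.O r.lat := isInvertibleRightIdeal_of_mem_rightIdeals hr.1
  obtain ⟨Φ, hΦ⟩ := S.exists_isLevelShape_iff S.nplus_ne_zero hlm
  have hIP := isInvertibleRightIdeal_mul_atkinLehnerIdeal Φ hO hΦ (isUnit_of_ne_zero S) hI
  refine ⟨mem_rightIdeals_of_isInvertibleRightIdeal (isUnit_of_ne_zero S) hO hIP, fun x => ?_⟩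
  rw [GrossRep.mulRight_emb, GrossRep.mulRight_lat, leftOrder_mul_atkinLehnerIdeal S hlm hI]
  exact hr.2 x

/-- **`W_{l⁺}` maps `H(c)` to `H(c)`** (`l ∤ N⁻`). [cite: BertoliniDarmon1996, §2.3 Lemma 2.4–2.5] -/
theorem atkinLehnerPlus_mem_grossPoints (hlm : ¬ l ∣ Nminus) {c : ℕ} {x : GrossSpace S.D K}
    (hx : x ∈ grossPoints K S c) : atkinLehnerPlus S l x ∈ grossPoints K S c := by
  obtain ⟨r, rfl, hr⟩ := hx
  rw [atkinLehnerPlus_mk]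
  exact mk_mem_grossPoints_iff.mpr (hr.mulRight_atkinLehnerIdeal S hlm)

/-- **`W_{l⁺}` is an involution on `H(c)`**: `W_{l⁺} (W_{l⁺} x) = x` for every Gross point `x`
(`I 𝔔 𝔔 = l^e I` and `[(f, l^e I)] = [l^e • (f, I)] = [(f, I)]`, `l^e` being central). [cite: BertoliniDarmon1996, §1.5 and §2.3 Lemma 2.5 (proof)] [cite: VignerasLNM800, Ch. II §2 (normalisateur)] -/
theorem atkinLehnerPlus_atkinLehnerPlus (hlm : ¬ l ∣ Nminus) {c : ℕ} {x : GrossSpace S.D K}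
    (hx : x ∈ grossPoints K S c) : atkinLehnerPlus S l (atkinLehnerPlus S l x) = x := by
  obtain ⟨r, rfl, hr⟩ := hx
  have hO : IsZOrder S.O := S.toEichlerPackage.isEichlerOrder.isZOrder
  have hI : IsInvertibleRightIdeal S.O r.lat := isInvertibleRightIdeal_of_mem_rightIdeals hr.1
  obtain ⟨Φ, hΦ⟩ := S.exists_isLevelShape_iff S.nplus_ne_zero hlm
  set m : ℕ := l ^ Nplus.factorization l with hm
  have hm0 : m ≠ 0 := pow_ne_zero _ hl.out.ne_zero
  have hPP : r.lat * atkinLehnerIdeal S.O m * atkinLehnerIdeal S.O m = ((m : ℕ) : ℤ) • r.lat :=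
    mul_atkinLehnerIdeal_mul_atkinLehnerIdeal Φ hO hΦ (isUnit_of_ne_zero S) hI
  obtain ⟨ν, hν, -⟩ := Brandt.exists_units_val_eq_natCast (D := S.D) hm0
  have hqI : ((m : ℕ) : ℤ) • r.lat = ν • r.lat := by
    ext y
    constructor
    · intro hy
      obtain ⟨z, hz, rfl⟩ := (Submodule.mem_smul_pointwise_iff_exists y _ r.lat).mp hy
      exact Brandt.units_smul_eq_zsmul_of_val_eq hν r.lat hz
    · intro hy
      obtain ⟨z, hz, rfl⟩ := Brandt.exists_eq_zsmul_of_mem_units_smul hν hy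
      exact Submodule.smul_mem_pointwise_smul z _ r.lat hz
  rw [atkinLehnerPlus_mk, atkinLehnerPlus_mk]
  have e : GrossRep.mulRight (atkinLehnerIdeal S.O m) (GrossRep.mulRight (atkinLehnerIdeal S.O m) r) = ν • r := by
    ext : 1
    · change r.emb = (unitConj ν).comp r.emb
      ext z
      rw [AlgHom.comp_apply, unitConj_apply, Units.eq_mul_inv_iff_mul_eq, hν]
      exact ((Int.cast_commute ((m : ℕ) : ℤ) (r.emb z)).eq).symm
    · change r.lat * atkinLehnerIdeal S.O m * atkinLehnerIdeal S.O m = ν • r.lat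
      rw [hPP, hqI]
  rw [e, mk_units_smul]

/-- **`W_{l⁺}` commutes with the action of `Pic(𝒪_c)` on `H(c)`**: `σ • W_{l⁺} x = W_{l⁺} (σ • x)`
(`f(𝔞) (I 𝔔) = (f(𝔞) I) 𝔔`). [cite: BertoliniDarmon1996, §2.3 Lemma 2.4] -/
theorem picard_smul_atkinLehnerPlus (l : ℕ) {c : ℕ} [NeZero c] {x : GrossSpace S.D K}
    (hx : x ∈ grossPoints K S c) (σ : ClassGroup (quadOrder K c)) :
    σ • atkinLehnerPlus S l x = atkinLehnerPlus S l (σ • x) := by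
  obtain ⟨r, rfl, hr⟩ := hx
  have hsat : IsSaturated c (mk r) := isSaturated_of_mem_grossPoints ⟨r, rfl, hr⟩
  have hsat' : IsSaturated c (mk (GrossRep.mulRight (atkinLehnerIdeal S.O (l ^ Nplus.factorization l)) r)) := by
    refine isSaturated_mk_of_forall_mem_leftOrder c fun a ha => ?_
    rw [GrossRep.mulRight_emb, GrossRep.mulRight_lat]
    exact leftOrder_le_leftOrder_mul_right S _ _ ((hr.2 a).mpr ha)
  refine ClassGroup.induction (K := K) (fun 𝔞 => ?_) σ
  rw [atkinLehnerPlus_mk, picard_mk_smul_mk c 𝔞 _ hsat', picard_mk_smul_mk c 𝔞 _ hsat, atkinLehnerPlus_mk]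
  congr 1
  ext : 1
  · rfl
  · change GrossRep.embLattice r.emb _ * (r.lat * _) = GrossRep.embLattice r.emb _ * r.lat * _
    rw [mul_assoc]

/-- **The `W_{l⁺}` commute**: `W_{l⁺} W_{l'⁺} = W_{l'⁺} W_{l⁺}` on the Gross space (`𝔔_{l^e} 𝔔_{l'^{e'}} =
𝔔_{l'^{e'}} 𝔔_{l^e}`). [cite: BertoliniDarmon1996, §2.3 Lemma 2.5 (proof)] -/
theorem atkinLehnerPlus_comm {l' : ℕ} [hl' : Fact l'.Prime] (x : GrossSpace S.D K) :
    atkinLehnerPlus S l (atkinLehnerPlus S l' x) = atkinLehnerPlus S l' (atkinLehnerPlus S l x) := by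
  by_cases hll : l = l'
  · subst hll; rfl
  have hO : IsZOrder S.O := S.toEichlerPackage.isEichlerOrder.isZOrder
  have hcomm := atkinLehnerIdeal_mul_atkinLehnerIdeal_comm hO (pow_ne_zero (Nplus.factorization l) hl.out.ne_zero)
    (pow_ne_zero (Nplus.factorization l') hl'.out.ne_zero)
    (Nat.Coprime.pow _ _ ((Nat.coprime_primes hl.out hl'.out).mpr hll))
  induction x using ind with
  | h r =>
    rw [atkinLehnerPlus_mk, atkinLehnerPlus_mk, atkinLehnerPlus_mk, atkinLehnerPlus_mk]
    congr 1
    ext : 1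
    · rw [GrossRep.mulRight_emb, GrossRep.mulRight_emb, GrossRep.mulRight_emb, GrossRep.mulRight_emb]
    · rw [GrossRep.mulRight_lat, GrossRep.mulRight_lat, GrossRep.mulRight_lat, GrossRep.mulRight_lat,
        mul_assoc, mul_assoc, hcomm]

/-- **`W_{l⁺}` and `W_{q⁻}` commute** (`l ≠ q`): `𝔔_{l^e} 𝔓_q = 𝔓_q 𝔔_{l^e}`. [cite: BertoliniDarmon1996, §2.3 Lemma 2.5 (proof)] -/
theorem atkinLehnerPlus_atkinLehner_comm {q : ℕ} [hq : Fact q.Prime] (hlq : l ≠ q) (x : GrossSpace S.D K) :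
    atkinLehnerPlus S l (atkinLehner S q x) = atkinLehner S q (atkinLehnerPlus S l x) := by
  have hO : IsZOrder S.O := S.toEichlerPackage.isEichlerOrder.isZOrder
  have hcomm := atkinLehnerIdeal_mul_normPrimeIdeal_comm hO (m := l ^ Nplus.factorization l)
    (pow_ne_zero _ hl.out.ne_zero) (q := q) fun h =>
      hlq ((Nat.prime_dvd_prime_iff_eq hq.out hl.out).mp (hq.out.dvd_of_dvd_pow h)).symm
  induction x using ind with
  | h r =>
    rw [atkinLehnerPlus_mk, atkinLehner_mk, atkinLehnerPlus_mk, atkinLehner_mk]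
    congr 1
    ext : 1
    · rw [GrossRep.mulRight_emb, GrossRep.mulRight_emb, GrossRep.mulRight_emb, GrossRep.mulRight_emb]
    · rw [GrossRep.mulRight_lat, GrossRep.mulRight_lat, GrossRep.mulRight_lat, GrossRep.mulRight_lat,
        mul_assoc, mul_assoc, hcomm]

end Heegner

end GrossSpace

/-! ### §2 At a level prime `l ∤ c d_K`, `W_{l⁺}` moves every Gross point off its `Pic(𝒪_c)`-orbit -/

namespace GrossPointsAtkinLehner

open GrossPointsCount GrossPointTowerExistence

variable {K : Type u} [Field K] [NumberField K] {Nplus Nminus : ℕ} (S : Brandt.XiSetup Nplus Nminus)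
variable (h2 : finrank ℚ K = 2) (b : Basis (Fin 2) ℤ (𝓞 K)) (hb : b 0 = 1) (f : K →ₐ[ℚ] S.D)

/-- A unit fixing `f` under conjugation centralises `f(K)`. [folklore] -/
private theorem mul_apply_eq_of_unitConj_comp_eq {bb : S.Dˣ} (h : (unitConj bb).comp f = f) (z : K) :
    (bb : S.D) * f z = f z * bb := by
  have hx := DFunLike.congr_fun h z
  rw [AlgHom.comp_apply, unitConj_apply] at hx
  calc (bb : S.D) * f z = ((bb : S.D) * f z * ↑bb⁻¹) * bb := by rw [Units.inv_mul_cancel_right]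
    _ = f z * bb := by rw [hx]

/-- A unit lies in the local lattice it generates (`1 ∈ O ⊆ O_q`). [folklore] -/
private theorem coe_units_mem_smul_localAt (hO : IsZOrder S.O) (q : ℕ) (x : S.Dˣ) :
    (x : S.D) ∈ x • localAt q S.O := by
  have h := Submodule.smul_mem_pointwise_smul (1 : S.D) x (localAt q S.O) (le_localAt q _ hO.one_mem)
  rwa [Units.smul_def, smul_eq_mul, mul_one] at h

omit [NumberField K] in
/-- `Φ(u⁻¹) Φ(u) = 1` and `Φ(u) Φ(u⁻¹) = 1` for a unit `u`. [folklore] -/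
private theorem map_units_inv_mul {l : ℕ} [Fact l.Prime] (Φ : S.D →ₐ[ℚ] Matrix (Fin 2) (Fin 2) ℚ_[l]) (u : S.Dˣ) :
    Φ ((u⁻¹ : S.Dˣ) : S.D) * Φ (u : S.D) = 1 ∧ Φ (u : S.D) * Φ ((u⁻¹ : S.Dˣ) : S.D) = 1 := by
  constructor <;> rw [← map_mul] <;> simp

omit [NumberField K] in
/-- **A local unit has unit orientation characters**: if `Φ(v)` and `Φ(v⁻¹)` are both level-shaped
(`e ≥ 1`) then `‖Φ(v)₀₀‖ = ‖Φ(v)₁₁‖ = 1` (the characters `X ↦ X₀₀, X₁₁ (mod l)` are multiplicative and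
`1 ↦ 1`). [cite: BertoliniDarmon1996, §1.1 (orientations of an Eichler order)] -/
private theorem norm_diag_eq_one_of_units {l : ℕ} [Fact l.Prime] {e : ℕ} (he : 1 ≤ e)
    (Φ : S.D →ₐ[ℚ] Matrix (Fin 2) (Fin 2) ℚ_[l]) {v : S.Dˣ} (hv : IsLevelShape e (Φ (v : S.D)))
    (hv' : IsLevelShape e (Φ ((v⁻¹ : S.Dˣ) : S.D))) : ‖Φ (v : S.D) 0 0‖ = 1 ∧ ‖Φ (v : S.D) 1 1‖ = 1 := by
  have h1 := (map_units_inv_mul S Φ v).2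
  constructor
  · refine le_antisymm (hv.1 0 0) (not_lt.mp fun hlt => ?_)
    have h := norm_mul_apply_zero_zero_lt_one he hv hv' hlt
    rw [h1, Matrix.one_apply_eq, norm_one] at h
    exact lt_irrefl _ h
  · refine le_antisymm (hv.1 1 1) (not_lt.mp fun hlt => ?_)
    have h := norm_mul_apply_one_one_lt_one he hv hv' hlt
    rw [h1, Matrix.one_apply_eq, norm_one] at h
    exact lt_irrefl _ h

include hb in
/-- **Core of the off-orbit argument at a level prime (local data at `l`).** Let `[(f, I)]` be a Gross
point of conductor `c`, `l ∤ c d_K` a prime with a level-`l^e` model `Φ` of `O` (`e ≥ 1`) and an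
Atkin–Lehner element `w` (`Φ(w)` of Atkin–Lehner shape, `‖nrd w‖_l = l^{-e}`), and `J` a lattice with
`I_l = β O_l` (`β ∈ I`), `J_l = β' O_l` (`β' ∈ J`) and `J_l = β w O_l` (e.g. `J = I 𝔔_{l^e} 𝔄` for any
two-sided `𝔄` trivial at `l`). Then `σ • [(f, I)] ≠ [(f, J)]` for every `σ ∈ Pic(𝒪_c)`.
Proof: `σ = [𝔞]` and `[(f, f(𝔞) I)] = [(f, J)]` give `b ∈ Dˣ` centralising `f(K)` with `b J = f(𝔞) I`.
For `a ∈ f(𝔞)`, `a' ∈ f(𝔞⁻¹)`: `x_a := w⁻¹ β⁻¹ b⁻¹ a β ∈ O_l` (as `a β ∈ f(𝔞) I = b J ⊆ b β w O_l`) and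
`y_{a'} := β⁻¹ a' b β' ∈ O_l` (as `f(𝔞⁻¹) b J = f(𝔞⁻¹) f(𝔞) I = f(𝒪_c) I ⊆ I ⊆ β O_l`), with
`Φ(x_a) Φ(y_{a'}) = Φ(w⁻¹ β⁻¹ (a a') β')` additive in `a a'`; since `1 ∈ f(𝒪_c) = f(𝔞) f(𝔞⁻¹)` maps to the
local unit `w⁻¹ β⁻¹ β'`, the orientation characters `X ↦ X₀₀, X₁₁ (mod l)` (multiplicative on the
level-`l^e` order) show that some `a ∈ f(𝔞)` has `Φ(x_a) ∈ O_lˣ`. Then `u := β⁻¹ b⁻¹ a β = w x_a` is an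
Atkin–Lehner generator (`Φ(u)` AL-shaped, `‖nrd u‖_l = l^{-e}`) commuting with `γ' := β⁻¹ γ_c β ∈ O_l`
(`b` centralises `f(K) ∋ a, γ_c`), whose discriminant `t_c² − 4 n_c = c² d_K` is an `l`-adic unit —
contradicting `AtkinLehner.norm_disc_lt_one_of_commute`. This is Bertolini–Darmon's "`W_{l⁺}` sends a
Heegner point to one with the opposite orientation at `l`" / "the orbits of `Pic(O)` correspond exactly to
the Heegner points with a given orientation", in a form that needs no choice of orientation. [cite: BertoliniDarmon1996, §2.2–§2.3, Lemma 2.4 and proof of Lemma 2.5] [cite: VignerasLNM800, Ch. II §2 (normalisateur d'un ordre d'Eichler)] -/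
theorem picard_smul_mk_ne_mk_of_localAt_eq_level {c : ℕ} [NeZero c] {l : ℕ} [hl : Fact l.Prime]
    (hlc : ¬ l ∣ c) (hld : ¬ (l : ℤ) ∣ NumberField.discr K) {e : ℕ} (he : 1 ≤ e)
    (Φ : S.D →ₐ[ℚ] Matrix (Fin 2) (Fin 2) ℚ_[l]) (hΦ : ∀ y : S.D, y ∈ localAt l S.O ↔ IsLevelShape e (Φ y))
    {w : S.Dˣ} (hW : IsALShape e (Φ (w : S.D))) (hdet : ‖(Φ (w : S.D)).det‖ = (l : ℝ) ^ (-(e : ℤ)))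
    {I J : Submodule ℤ S.D} (hr : (⟨f, I⟩ : GrossRep S.D K).IsHeegner S.O c)
    {β β' : S.Dˣ} (hβI : (β : S.D) ∈ I) (hβ : localAt l I = β • localAt l S.O)
    (hβ'J : (β' : S.D) ∈ J) (hβ' : localAt l J = β' • localAt l S.O)
    (hJw : localAt l J = (β * w) • localAt l S.O) (σ : ClassGroup (quadOrder K c)) :
    σ • GrossSpace.mk (⟨f, I⟩ : GrossRep S.D K) ≠ GrossSpace.mk ⟨f, J⟩ := by
  haveI : Nontrivial S.D := Brandt.nontrivial_of_isQuaternionAlgebra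
  have hO : IsZOrder S.O := S.toEichlerPackage.isEichlerOrder.isZOrder
  have hc : c ≠ 0 := NeZero.ne c
  have hp1 : (1 : ℝ) < l := by exact_mod_cast hl.out.one_lt
  have hr0 : (0 : ℝ) < (l : ℝ) ^ (-(e : ℤ)) := zpow_pos (by positivity) _
  have hsat : GrossSpace.IsSaturated c (GrossSpace.mk (⟨f, I⟩ : GrossRep S.D K)) :=
    GrossSpace.isSaturated_of_mem_grossPoints ⟨_, rfl, hr⟩
  refine ClassGroup.induction (K := K) (fun 𝔞 => ?_) σ
  intro heq
  rw [GrossSpace.picard_mk_smul_mk c 𝔞 _ hsat, GrossSpace.mk_eq_mk_iff] at heq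
  obtain ⟨bb, hbb⟩ := heq
  set A := GrossRep.embLattice f (fracIdealLattice c (𝔞 : FractionalIdeal (quadOrder K c)⁰ K)) with hA
  set A' := GrossRep.embLattice f
    (fracIdealLattice c ((𝔞⁻¹ : (FractionalIdeal (quadOrder K c)⁰ K)ˣ) : FractionalIdeal (quadOrder K c)⁰ K))
    with hA'
  have hemb : (unitConj bb).comp f = f := congrArg GrossRep.emb hbb
  have hlat : bb • J = A * I := congrArg GrossRep.lat hbb
  have hcomm : ∀ z : K, (bb : S.D) * f z = f z * bb := mul_apply_eq_of_unitConj_comp_eq S f hemb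
  -- `f(𝔞) f(𝔞⁻¹) = f(𝔞⁻¹) f(𝔞) = f(𝒪_c) ∋ 1`, `f(𝒪_c) I ⊆ I`
  have hAA' : A * A' = ordLat f c := by
    rw [hA, hA', ← GrossRep.embLattice_mul, ← fracIdealLattice_mul, ← Units.val_mul, mul_inv_cancel,
      Units.val_one, fracIdealLattice_one]; rfl
  have hA'A : A' * A = ordLat f c := by
    rw [hA, hA', ← GrossRep.embLattice_mul, ← fracIdealLattice_mul, ← Units.val_mul, inv_mul_cancel,
      Units.val_one, fracIdealLattice_one]; rfl
  have hRI : ordLat f c * I ≤ I := Submodule.mul_le.mpr fun x hx y hy => by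
    obtain ⟨z, hz, rfl⟩ := GrossRep.mem_embLattice_iff.mp hx
    exact (hr.2 z).mpr hz y hy
  have h1R : (1 : S.D) ∈ ordLat f c := GrossRep.one_mem_embLattice_quadOrder f c
  -- (i) `x_a := w⁻¹ β⁻¹ bb⁻¹ a β ∈ O_l` for `a ∈ f(𝔞)`
  set g : S.Dˣ := w⁻¹ * β⁻¹ * bb⁻¹ with hg
  have hxmem : ∀ a ∈ A, (g : S.D) * a * β ∈ localAt l S.O := by
    intro a ha
    have h1 : a * (β : S.D) ∈ bb • J := by rw [hlat]; exact Submodule.mul_mem_mul ha hβI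
    have hle : bb • J ≤ (bb * (β * w)) • localAt l S.O := by
      rw [mul_smul, ← hJw, ← localAt_units_smul]; exact le_localAt l _
    have h3 := hle h1
    rw [mem_units_smul_submodule_iff, Units.smul_def, smul_eq_mul] at h3
    have e1 : (g : S.D) * a * β = (((bb * (β * w))⁻¹ : S.Dˣ) : S.D) * (a * β) := by
      simp only [hg, mul_inv_rev, Units.val_mul, mul_assoc]
    rw [e1]; exact h3
  -- (ii) `y_{a'} := β⁻¹ a' bb β' ∈ O_l` for `a' ∈ f(𝔞⁻¹)`
  have hymem : ∀ a' ∈ A', ((β⁻¹ : S.Dˣ) : S.D) * (a' * ((bb : S.D) * β')) ∈ localAt l S.O := by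
    intro a' ha'
    have h1 : a' * ((bb : S.D) * β') ∈ I := by
      have hbβ' : (bb : S.D) * β' ∈ A * I := by
        rw [← hlat]; exact Submodule.smul_mem_pointwise_smul _ bb _ hβ'J
      have hle : A' * (A * I) ≤ I := by rw [← mul_assoc, hA'A]; exact hRI
      exact hle (Submodule.mul_mem_mul ha' hbβ')
    have h3 : a' * ((bb : S.D) * β') ∈ β • localAt l S.O := by rw [← hβ]; exact le_localAt l _ h1
    rw [mem_units_smul_submodule_iff, Units.smul_def, smul_eq_mul] at h3
    exact h3
  -- the conjugation `Z(z) = Φ(w⁻¹ β⁻¹ z β')`, additive in `z`, with `Z(a a') = Φ(x_a) Φ(y_{a'})`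
  set Z : S.D → Matrix (Fin 2) (Fin 2) ℚ_[l] := fun z => Φ ((((w⁻¹ * β⁻¹ : S.Dˣ)) : S.D) * z * β') with hZ
  have hZadd : ∀ z z' : S.D, Z (z + z') = Z z + Z z' := fun z z' => by
    simp only [hZ, mul_add, add_mul, map_add]
  have hZmul : ∀ a ∈ A, ∀ a' ∈ A', Z (a * a') = Φ ((g : S.D) * a * β) * Φ (((β⁻¹ : S.Dˣ) : S.D) * (a' * ((bb : S.D) * β'))) := by
    intro a ha a' ha'
    obtain ⟨z, -, rfl⟩ := GrossRep.mem_embLattice_iff.mp ha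
    obtain ⟨z', -, rfl⟩ := GrossRep.mem_embLattice_iff.mp ha'
    -- `w⁻¹ β⁻¹ (f z f z') β' = (w⁻¹ β⁻¹ bb⁻¹ f z β) (β⁻¹ (f z' (bb β')))`, using `bb (f z f z') = (f z f z') bb`
    have hc3 : ((bb⁻¹ : S.Dˣ) : S.D) * (f z * f z') * bb = f z * f z' := by
      rw [← map_mul f, mul_assoc, Units.inv_mul_eq_iff_eq_mul, hcomm]
    simp only [hZ]
    rw [← map_mul Φ]
    congr 1
    rw [hg, Units.val_mul, Units.val_mul, Units.val_mul]
    calc (((w⁻¹ : S.Dˣ) : S.D) * ((β⁻¹ : S.Dˣ) : S.D)) * (f z * f z') * β'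
        = ((w⁻¹ : S.Dˣ) : S.D) * ((β⁻¹ : S.Dˣ) : S.D) * (((bb⁻¹ : S.Dˣ) : S.D) * (f z * f z') * bb) * β' := by
          rw [hc3]
      _ = ((w⁻¹ : S.Dˣ) : S.D) * ((β⁻¹ : S.Dˣ) : S.D) * ((bb⁻¹ : S.Dˣ) : S.D) * f z * β *
            (((β⁻¹ : S.Dˣ) : S.D) * (f z' * ((bb : S.D) * β'))) := by
          simp only [mul_assoc, Units.mul_inv_cancel_left]
  -- shapes
  have hXshape : ∀ a ∈ A, IsLevelShape e (Φ ((g : S.D) * a * β)) := fun a ha => (hΦ _).mp (hxmem a ha)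
  have hYshape : ∀ a' ∈ A', IsLevelShape e (Φ (((β⁻¹ : S.Dˣ) : S.D) * (a' * ((bb : S.D) * β')))) :=
    fun a' ha' => (hΦ _).mp (hymem a' ha')
  -- `Z(1) = Φ(v)`, `v = w⁻¹ β⁻¹ β'` a unit of `O_l`
  set v : S.Dˣ := w⁻¹ * β⁻¹ * β' with hv
  have hZ1 : Z 1 = Φ (v : S.D) := by rw [hZ, hv]; simp only [mul_one, Units.val_mul]
  have hvO : (v : S.D) ∈ localAt l S.O := by
    have h : (β' : S.D) ∈ (β * w) • localAt l S.O := by rw [← hJw]; exact le_localAt l _ hβ'J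
    rw [mem_units_smul_submodule_iff, Units.smul_def, smul_eq_mul, mul_inv_rev] at h
    rw [hv, Units.val_mul]; exact h
  have hvO' : ((v⁻¹ : S.Dˣ) : S.D) ∈ localAt l S.O := by
    have h : ((β * w : S.Dˣ) : S.D) ∈ β' • localAt l S.O := by rw [← hβ', hJw]; exact coe_units_mem_smul_localAt S hO l _
    rw [mem_units_smul_submodule_iff, Units.smul_def, smul_eq_mul] at h
    rw [hv, mul_inv_rev, mul_inv_rev, inv_inv, inv_inv, Units.val_mul, Units.val_mul]
    rwa [Units.val_mul] at h
  obtain ⟨hv00, hv11⟩ := norm_diag_eq_one_of_units S he Φ ((hΦ _).mp hvO) ((hΦ _).mp hvO')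
  -- (iv) some `a₁ ∈ f(𝔞)` with `‖Φ(x_{a₁})₀₀‖ = 1`, some `a₂` with `‖Φ(x_{a₂})₁₁‖ = 1`
  have h1AA : (1 : S.D) ∈ A * A' := by rw [hAA']; exact h1R
  have hex0 : ∃ a ∈ A, ‖Φ ((g : S.D) * a * β) 0 0‖ = 1 := by
    by_contra hne
    push Not at hne
    have hall : ∀ a ∈ A, ‖Φ ((g : S.D) * a * β) 0 0‖ < 1 := fun a ha =>
      lt_of_le_of_ne ((hXshape a ha).1 0 0) (hne a ha)
    have key : ∀ z ∈ A * A', ‖Z z 0 0‖ < 1 := by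
      intro z hz
      refine Submodule.mul_induction_on hz (fun a ha a' ha' => ?_) (fun z z' hz hz' => ?_)
      · rw [hZmul a ha a' ha']
        exact norm_mul_apply_zero_zero_lt_one he (hXshape a ha) (hYshape a' ha') (hall a ha)
      · rw [hZadd, Matrix.add_apply]
        exact lt_of_le_of_lt (Padic.nonarchimedean _ _) (max_lt hz hz')
    have h := key 1 h1AA
    rw [hZ1, hv00] at h
    exact lt_irrefl _ h
  have hex1 : ∃ a ∈ A, ‖Φ ((g : S.D) * a * β) 1 1‖ = 1 := by
    by_contra hne
    push Not at hne
    have hall : ∀ a ∈ A, ‖Φ ((g : S.D) * a * β) 1 1‖ < 1 := fun a ha =>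
      lt_of_le_of_ne ((hXshape a ha).1 1 1) (hne a ha)
    have key : ∀ z ∈ A * A', ‖Z z 1 1‖ < 1 := by
      intro z hz
      refine Submodule.mul_induction_on hz (fun a ha a' ha' => ?_) (fun z z' hz hz' => ?_)
      · rw [hZmul a ha a' ha']
        exact norm_mul_apply_one_one_lt_one he (hXshape a ha) (hYshape a' ha') (hall a ha)
      · rw [hZadd, Matrix.add_apply]
        exact lt_of_le_of_lt (Padic.nonarchimedean _ _) (max_lt hz hz')
    have h := key 1 h1AA
    rw [hZ1, hv11] at h
    exact lt_irrefl _ h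
  -- (v) some `a ∈ f(𝔞)` with both diagonal entries of `Φ(x_a)` units
  have hex : ∃ a ∈ A, ‖Φ ((g : S.D) * a * β) 0 0‖ = 1 ∧ ‖Φ ((g : S.D) * a * β) 1 1‖ = 1 := by
    obtain ⟨a₁, ha₁, h₁⟩ := hex0
    obtain ⟨a₂, ha₂, h₂⟩ := hex1
    by_cases h₁' : ‖Φ ((g : S.D) * a₁ * β) 1 1‖ = 1
    · exact ⟨a₁, ha₁, h₁, h₁'⟩
    by_cases h₂' : ‖Φ ((g : S.D) * a₂ * β) 0 0‖ = 1
    · exact ⟨a₂, ha₂, h₂', h₂⟩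
    have hlt₁ : ‖Φ ((g : S.D) * a₁ * β) 1 1‖ < 1 := lt_of_le_of_ne ((hXshape a₁ ha₁).1 1 1) h₁'
    have hlt₂ : ‖Φ ((g : S.D) * a₂ * β) 0 0‖ < 1 := lt_of_le_of_ne ((hXshape a₂ ha₂).1 0 0) h₂'
    refine ⟨a₁ + a₂, A.add_mem ha₁ ha₂, ?_, ?_⟩
    · rw [mul_add, add_mul, map_add, Matrix.add_apply, Padic.add_eq_max_of_ne (by rw [h₁]; exact hlt₂.ne'), h₁]
      exact max_eq_left hlt₂.le
    · rw [mul_add, add_mul, map_add, Matrix.add_apply, add_comm,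
        Padic.add_eq_max_of_ne (by rw [h₂]; exact hlt₁.ne'), h₂]
      exact max_eq_left hlt₁.le
  obtain ⟨a, ha, ha00, ha11⟩ := hex
  obtain ⟨z, -, rfl⟩ := GrossRep.mem_embLattice_iff.mp ha
  -- (vi) the Atkin–Lehner generator `u = w x_a = β⁻¹ bb⁻¹ (f z) β` commuting with `γ' = β⁻¹ γ_c β`
  set X := Φ ((g : S.D) * f z * β) with hX
  have hXs : IsLevelShape e X := hXshape _ ha
  have hdetX : ‖X.det‖ = 1 := norm_det_eq_one_of_diag he hXs ha00 ha11
  set u : S.D := ((β⁻¹ * bb⁻¹ : S.Dˣ) : S.D) * f z * β with hu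
  have hwu : (w : S.D) * ((g : S.D) * f z * β) = u := by
    rw [hu, hg, Units.val_mul, Units.val_mul, Units.val_mul]
    simp only [← mul_assoc, Units.mul_inv, one_mul]
  have hU : IsALShape e (Φ u) := by
    rw [← hwu, map_mul]; exact hW.mul_isLevelShape hXs
  have hdetU : ‖(Φ u).det‖ = (l : ℝ) ^ (-(e : ℤ)) := by
    rw [← hwu, map_mul, Matrix.det_mul, norm_mul, hdet, ← hX, hdetX, mul_one]
  set γ' : S.D := ((β⁻¹ : S.Dˣ) : S.D) * gammaC S b f c * β with hγ'
  have hγmem : gammaC S b f c ∈ ordLat f c :=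
    (mem_ordLat_iff_gammaC S b hb f c _).mpr ⟨0, 1, by simp⟩
  have hG : IsLevelShape e (Φ γ') := by
    rw [← hΦ]
    have h1 : gammaC S b f c * (β : S.D) ∈ I := hRI (Submodule.mul_mem_mul hγmem hβI)
    have h3 : gammaC S b f c * (β : S.D) ∈ β • localAt l S.O := by rw [← hβ]; exact le_localAt l _ h1
    rw [mem_units_smul_submodule_iff, Units.smul_def, smul_eq_mul, ← mul_assoc] at h3
    exact h3
  have hcommGU : Φ γ' * Φ u = Φ u * Φ γ' := by
    rw [← map_mul, ← map_mul]
    congr 1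
    -- `γ_c` commutes with `bb⁻¹` and with `f z`
    have hc1 : ((bb⁻¹ : S.Dˣ) : S.D) * gammaC S b f c = gammaC S b f c * ((bb⁻¹ : S.Dˣ) : S.D) := by
      rw [gammaC_eq_apply, Units.inv_mul_eq_iff_eq_mul, ← mul_assoc, hcomm, mul_assoc, Units.mul_inv, mul_one]
    have hc4 : f z * gammaC S b f c = gammaC S b f c * f z := by
      rw [gammaC_eq_apply, ← map_mul, ← map_mul, mul_comm]
    rw [hγ', hu, Units.val_mul]
    calc ((β⁻¹ : S.Dˣ) : S.D) * gammaC S b f c * β * ((((β⁻¹ : S.Dˣ) : S.D) * ((bb⁻¹ : S.Dˣ) : S.D)) * f z * β)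
        = ((β⁻¹ : S.Dˣ) : S.D) * (gammaC S b f c * ((bb⁻¹ : S.Dˣ) : S.D) * f z) * β := by
          simp only [mul_assoc, Units.mul_inv_cancel_left]
      _ = ((β⁻¹ : S.Dˣ) : S.D) * (((bb⁻¹ : S.Dˣ) : S.D) * f z * gammaC S b f c) * β := by
          rw [← hc1, mul_assoc ((bb⁻¹ : S.Dˣ) : S.D), ← hc4, ← mul_assoc ((bb⁻¹ : S.Dˣ) : S.D)]
      _ = (((β⁻¹ : S.Dˣ) : S.D) * ((bb⁻¹ : S.Dˣ) : S.D)) * f z * β * (((β⁻¹ : S.Dˣ) : S.D) * gammaC S b f c * β) := by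
          simp only [mul_assoc, Units.mul_inv_cancel_left]
  -- the discriminant of `γ'` is `t_c² − 4 n_c = c² d_K`, an `l`-adic unit
  obtain ⟨htr, hnr⟩ := reducedTrace_gammaC_and_reducedNorm_gammaC S b hb f hc
  have hβinv := map_units_inv_mul S Φ β
  have htrace : (Φ γ').trace = ((tC b c : ℤ) : ℚ_[l]) := by
    rw [hγ', map_mul, map_mul, mul_assoc, Matrix.trace_mul_comm, mul_assoc, hβinv.2, mul_one,
      AlgHom.trace_eq_reducedTrace, htr]
    simp
  have hdetG : (Φ γ').det = ((nC b c : ℤ) : ℚ_[l]) := by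
    rw [hγ', map_mul, map_mul, Matrix.det_mul, Matrix.det_mul, mul_comm ((Φ _).det) , mul_assoc,
      ← Matrix.det_mul, hβinv.1, Matrix.det_one, mul_one, AlgHom.det_eq_reducedNorm, hnr]
    simp
  have hdisc : ‖(Φ γ').trace ^ 2 - 4 * (Φ γ').det‖ = 1 := by
    rw [htrace, hdetG]
    have e1 : (((tC b c : ℤ) : ℚ_[l])) ^ 2 - 4 * ((nC b c : ℤ) : ℚ_[l]) =
        (((c : ℤ) ^ 2 * NumberField.discr K : ℤ) : ℚ_[l]) := by
      rw [← tC_sq_sub_four_mul_nC b hb c]; push_cast; ring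
    rw [e1]
    refine le_antisymm (Padic.norm_int_le_one _) (not_lt.mp fun hlt => ?_)
    rw [Padic.norm_intCast_lt_one_iff] at hlt
    have hlZ : Prime (l : ℤ) := Nat.prime_iff_prime_int.mp hl.out
    rcases hlZ.dvd_or_dvd hlt with h | h
    · exact hlc (Int.natCast_dvd_natCast.mp (hlZ.dvd_of_dvd_pow h))
    · exact hld h
  have hlt := norm_disc_lt_one_of_commute he hU hdetU hG hcommGU
  rw [hdisc] at hlt
  exact lt_irrefl _ hlt

include hb in
/-- **`W_{l⁺}` moves every Gross point off its `Pic(𝒪_c)`-orbit** (BD96, proof of Lemma 2.5: "the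
involution `W_{l⁺}` … sends a Heegner point `P` to one with the opposite orientation at `l`", while by
Lemma 2.4 "the action of `Pic(O)` preserves the orientations"): for a prime `l ∣ N⁺`, `l ∤ N⁻`,
`l ∤ c d_K`, `σ • [(f, I)] ≠ W_{l⁺} [(f, I)] = [(f, I 𝔔_{l^e})]` for every `σ ∈ Pic(𝒪_c)`
(`picard_smul_mk_ne_mk_of_localAt_eq_level` with the level-`l^e` model of `O` and an Atkin–Lehner
generator of `𝔔_{l^e}`). [cite: BertoliniDarmon1996, §2.3 Lemma 2.4 and proof of Lemma 2.5] [cite: VignerasLNM800, Ch. II §2] -/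
theorem picard_smul_ne_atkinLehnerPlus {c : ℕ} [NeZero c] {l : ℕ} [hl : Fact l.Prime]
    (hlN : l ∣ Nplus) (hlm : ¬ l ∣ Nminus) (hlc : ¬ l ∣ c) (hld : ¬ (l : ℤ) ∣ NumberField.discr K)
    {I : Submodule ℤ S.D} (hr : (⟨f, I⟩ : GrossRep S.D K).IsHeegner S.O c)
    (σ : ClassGroup (quadOrder K c)) :
    σ • GrossSpace.mk (⟨f, I⟩ : GrossRep S.D K) ≠ GrossSpace.atkinLehnerPlus S l (GrossSpace.mk ⟨f, I⟩) := by
  have hD := GrossSpace.isUnit_of_ne_zero S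
  have hO : IsZOrder S.O := S.toEichlerPackage.isEichlerOrder.isZOrder
  have he : 1 ≤ Nplus.factorization l := hl.out.factorization_pos_of_dvd S.nplus_ne_zero hlN
  obtain ⟨Φ, hΦ⟩ := S.exists_isLevelShape_iff S.nplus_ne_zero hlm
  obtain ⟨w, hw, hW, hdet⟩ := exists_atkinLehner_generator Φ hO hΦ hD
  have hI : IsInvertibleRightIdeal S.O I := isInvertibleRightIdeal_of_mem_rightIdeals hr.1
  obtain ⟨β, hβI, hβ⟩ := hI.exists_localAt_eq_units_smul hD hO l
  obtain ⟨β', hβ'J, hβ'⟩ :=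
    (isInvertibleRightIdeal_mul_atkinLehnerIdeal Φ hO hΦ hD hI).exists_localAt_eq_units_smul hD hO l
  have hJw := localAt_mul_atkinLehnerIdeal_self Φ hO hΦ hβ hw hW hdet
  rw [GrossSpace.atkinLehnerPlus_mk]
  exact picard_smul_mk_ne_mk_of_localAt_eq_level S b hb f hlc hld he Φ hΦ hW hdet hr hβI hβ hβ'J hβ'
    hJw σ

include hb in
/-- **`W_{l⁺} x ∉ Pic(𝒪_c) • x`** for every Gross point `x` of conductor `c` (any representative),
`l ∣ N⁺`, `l ∤ N⁻ c d_K`. [cite: BertoliniDarmon1996, §2.3 Lemma 2.4 and proof of Lemma 2.5] -/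
theorem picard_smul_ne_atkinLehnerPlus_of_mem {c : ℕ} [NeZero c] {l : ℕ} [Fact l.Prime]
    (hlN : l ∣ Nplus) (hlm : ¬ l ∣ Nminus) (hlc : ¬ l ∣ c) (hld : ¬ (l : ℤ) ∣ NumberField.discr K)
    {x : GrossSpace S.D K} (hx : x ∈ grossPoints K S c) (σ : ClassGroup (quadOrder K c)) :
    σ • x ≠ GrossSpace.atkinLehnerPlus S l x := by
  obtain ⟨r, rfl, hr⟩ := hx
  obtain ⟨f', I⟩ := r
  exact picard_smul_ne_atkinLehnerPlus S b hb f' hlN hlm hlc hld hr σ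

/-- The translates `σ • W_{l⁺}^ε x` (`ε ∈ {0, 1}` as a `Bool`) of a Gross point are Gross points of the
same conductor. [cite: BertoliniDarmon1996, §2.3 (4) and Lemma 2.5 (proof)] -/
theorem picard_smul_cond_atkinLehnerPlus_mem {c : ℕ} [NeZero c] {l : ℕ} [Fact l.Prime] (hlm : ¬ l ∣ Nminus)
    {x : GrossSpace S.D K} (hx : x ∈ grossPoints K S c) (p : ClassGroup (quadOrder K c) × Bool) :
    p.1 • (cond p.2 (GrossSpace.atkinLehnerPlus S l x) x) ∈ grossPoints K S c := by
  refine picard_smul_mem_grossPoints ?_ p.1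
  cases p.2
  · exact hx
  · exact GrossSpace.atkinLehnerPlus_mem_grossPoints S hlm hx

include h2 hb in
/-- **`Pic(𝒪_c) × ⟨W_{l⁺}⟩` acts freely on `H_N(K; c)`** at a prime `l ∣ N⁺` (`l ∤ N⁻ c d_K`):
`(σ, ε) ↦ σ • W_{l⁺}^ε x` is injective for every Gross point `x` of conductor `c` (freeness of
`Pic(𝒪_c)`, tree `GrossSpace.picard_smul_left_injective`, and `picard_smul_ne_atkinLehnerPlus_of_mem`).
BD96: "the group `Pic(O) × W` acts simply transitively on the set `H_N(K; c)`" — here the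
`W_{l⁺}`-part for one `l ∣ N⁺`. [cite: BertoliniDarmon1996, §2.3 Lemma 2.5 (proof)] -/
theorem picard_atkinLehnerPlus_injective {c : ℕ} [NeZero c] {l : ℕ} [Fact l.Prime]
    (hlN : l ∣ Nplus) (hlm : ¬ l ∣ Nminus) (hlc : ¬ l ∣ c) (hld : ¬ (l : ℤ) ∣ NumberField.discr K)
    {x : GrossSpace S.D K} (hx : x ∈ grossPoints K S c) :
    Function.Injective fun p : ClassGroup (quadOrder K c) × Bool =>
      p.1 • (cond p.2 (GrossSpace.atkinLehnerPlus S l x) x) := by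
  have hb' := hb
  rintro ⟨σ, ε⟩ ⟨τ, ε'⟩ h
  have key : ∀ {σ τ : ClassGroup (quadOrder K c)}, σ • x ≠ τ • GrossSpace.atkinLehnerPlus S l x := by
    intro σ τ h
    apply picard_smul_ne_atkinLehnerPlus_of_mem S b hb' hlN hlm hlc hld hx (τ⁻¹ * σ)
    rw [mul_smul, h, ← mul_smul, inv_mul_cancel, one_smul]
  cases ε <;> cases ε'
  · exact Prod.ext (GrossSpace.picard_smul_left_injective S h2 hx h) rfl
  · exact absurd h key
  · exact absurd (Eq.symm h) key
  · exact Prod.ext (GrossSpace.picard_smul_left_injective S h2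
      (GrossSpace.atkinLehnerPlus_mem_grossPoints S hlm hx) h) rfl

end GrossPointsAtkinLehner

/-! ### §3 Products `W⁺_T = ∏_{l ∈ T} W_{l⁺}` (`T ⊆ {l ∣ N⁺}`): the group `W⁺ ≅ (ℤ/2ℤ)^{t⁺}` -/

namespace GrossSpace

variable {K : Type u} [Field K] [NumberField K] {Nplus Nminus : ℕ}

/-- **Products of the involutions `W_{l⁺}`**: for a list `ls = [l_1, …, l_k]`,
`W⁺_{ls} = W_{l_k⁺} ∘ ⋯ ∘ W_{l_1⁺}`, i.e. `[(f, I)] ↦ [(f, I 𝔔_{l_1^{e_1}} ⋯ 𝔔_{l_k^{e_k}})]` (the elements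
of the subgroup `⟨W_{l⁺} : l ∣ N⁺⟩` of BD96's Atkin–Lehner group `W`). [cite: BertoliniDarmon1996, §2.3 Lemma 2.5 (proof)] -/
def atkinLehnerPlusList (S : Brandt.XiSetup Nplus Nminus) : List ℕ → GrossSpace S.D K → GrossSpace S.D K
  | [] => id
  | l :: ls => atkinLehnerPlusList S ls ∘ atkinLehnerPlus S l

/-- `W⁺_{[]} = id`. [cite: BertoliniDarmon1996, §2.3 Lemma 2.5 (proof)] -/
@[simp] theorem atkinLehnerPlusList_nil (S : Brandt.XiSetup Nplus Nminus) (x : GrossSpace S.D K) :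
    atkinLehnerPlusList S [] x = x := rfl

/-- `W⁺_{l :: ls} = W⁺_{ls} ∘ W_{l⁺}`. [cite: BertoliniDarmon1996, §2.3 Lemma 2.5 (proof)] -/
@[simp] theorem atkinLehnerPlusList_cons (S : Brandt.XiSetup Nplus Nminus) (l : ℕ) (ls : List ℕ)
    (x : GrossSpace S.D K) :
    atkinLehnerPlusList S (l :: ls) x = atkinLehnerPlusList S ls (atkinLehnerPlus S l x) := rfl

/-- `W⁺_{ls} [(f, I)] = [(f, I 𝔔_{l_1^{e_1}} ⋯ 𝔔_{l_k^{e_k}})]`. [cite: BertoliniDarmon1996, §2.3 Lemma 2.5 (proof)] -/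
theorem atkinLehnerPlusList_mk (S : Brandt.XiSetup Nplus Nminus) (ls : List ℕ) (r : GrossRep S.D K) :
    atkinLehnerPlusList S ls (mk r) =
      mk ⟨r.emb, r.lat * (ls.map fun l => atkinLehnerIdeal S.O (l ^ Nplus.factorization l)).prod⟩ := by
  induction ls generalizing r with
  | nil =>
    obtain ⟨f, I⟩ := r
    simp only [atkinLehnerPlusList_nil, List.map_nil, List.prod_nil, mul_one]
  | cons q l ih =>
    rw [atkinLehnerPlusList_cons, atkinLehnerPlus_mk, ih]
    simp only [GrossRep.mulRight_emb, GrossRep.mulRight_lat, List.map_cons, List.prod_cons, mul_assoc]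

variable (S : Brandt.XiSetup Nplus Nminus)

/-- **`W⁺_{ls}` maps `H_N(K; c)` to itself** when every entry of `ls` is a prime not dividing `N⁻`. [cite: BertoliniDarmon1996, §2.3 Lemma 2.5 (proof)] -/
theorem atkinLehnerPlusList_mem_grossPoints {ls : List ℕ} (hl : ∀ l ∈ ls, l.Prime ∧ ¬ l ∣ Nminus) {c : ℕ}
    {x : GrossSpace S.D K} (hx : x ∈ grossPoints K S c) : atkinLehnerPlusList S ls x ∈ grossPoints K S c := by
  induction ls generalizing x with
  | nil => exact hx
  | cons q l ih =>
    haveI : Fact q.Prime := ⟨(hl q List.mem_cons_self).1⟩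
    exact ih (fun q' hq' => hl q' (List.mem_cons_of_mem q hq'))
      (atkinLehnerPlus_mem_grossPoints S (hl q List.mem_cons_self).2 hx)

/-- **`W⁺_{ls}` commutes with `Pic(𝒪_c)` on `H_N(K; c)`.** [cite: BertoliniDarmon1996, §2.3 Lemma 2.4] -/
theorem picard_smul_atkinLehnerPlusList {ls : List ℕ} (hl : ∀ l ∈ ls, l.Prime ∧ ¬ l ∣ Nminus) {c : ℕ}
    [NeZero c] {x : GrossSpace S.D K} (hx : x ∈ grossPoints K S c) (σ : ClassGroup (quadOrder K c)) :
    σ • atkinLehnerPlusList S ls x = atkinLehnerPlusList S ls (σ • x) := by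
  induction ls generalizing x with
  | nil => rfl
  | cons q l ih =>
    haveI : Fact q.Prime := ⟨(hl q List.mem_cons_self).1⟩
    rw [atkinLehnerPlusList_cons, atkinLehnerPlusList_cons,
      ih (fun q' hq' => hl q' (List.mem_cons_of_mem q hq'))
        (atkinLehnerPlus_mem_grossPoints S (hl q List.mem_cons_self).2 hx),
      picard_smul_atkinLehnerPlus S q hx σ]

/-- **`W⁺_{ls}` only depends on `ls` up to reordering** (the `W_{l⁺}` commute). [cite: BertoliniDarmon1996, §2.3 Lemma 2.5 (proof)] -/
theorem atkinLehnerPlusList_perm {l l' : List ℕ} (h : l.Perm l') (hl : ∀ q ∈ l, q.Prime ∧ ¬ q ∣ Nminus)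
    (x : GrossSpace S.D K) : atkinLehnerPlusList S l x = atkinLehnerPlusList S l' x := by
  induction h generalizing x with
  | nil => rfl
  | cons a _ ih =>
    rw [atkinLehnerPlusList_cons, atkinLehnerPlusList_cons]
    exact ih (fun q hq => hl q (List.mem_cons_of_mem a hq)) _
  | swap a b l =>
    haveI : Fact a.Prime := ⟨(hl a (List.mem_cons_of_mem b List.mem_cons_self)).1⟩
    haveI : Fact b.Prime := ⟨(hl b List.mem_cons_self).1⟩
    simp only [atkinLehnerPlusList_cons]
    rw [atkinLehnerPlus_comm S]
  | trans h₁ _ ih₁ ih₂ =>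
    rw [ih₁ hl, ih₂ (fun q hq => hl q (h₁.mem_iff.mpr hq))]

/-- `W⁺_{l₁ ++ l₂} = W⁺_{l₂} ∘ W⁺_{l₁}`. [cite: BertoliniDarmon1996, §2.3 Lemma 2.5 (proof)] -/
theorem atkinLehnerPlusList_append (l₁ l₂ : List ℕ) (x : GrossSpace S.D K) :
    atkinLehnerPlusList S (l₁ ++ l₂) x = atkinLehnerPlusList S l₂ (atkinLehnerPlusList S l₁ x) := by
  induction l₁ generalizing x with
  | nil => rfl
  | cons q l ih => exact ih _

/-- **`W_{l⁺}² = 1` inside a product**: `W⁺_{l :: l :: ls} x = W⁺_{ls} x` on `H_N(K; c)`. [cite: BertoliniDarmon1996, §2.3 Lemma 2.5 (proof)] -/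
theorem atkinLehnerPlusList_cons_cons_self {q : ℕ} [Fact q.Prime] (hqm : ¬ q ∣ Nminus) (l : List ℕ)
    {c : ℕ} {x : GrossSpace S.D K} (hx : x ∈ grossPoints K S c) :
    atkinLehnerPlusList S (q :: q :: l) x = atkinLehnerPlusList S l x := by
  rw [atkinLehnerPlusList_cons, atkinLehnerPlusList_cons, atkinLehnerPlus_atkinLehnerPlus S hqm hx]

/-- **Reduction to square-free words**: on `H_N(K; c)` every product `W⁺_{ls}` (`ls` any list of
primes not dividing `N⁻`) equals `W⁺_{ls'}` for a list `ls'` WITHOUT repetition consisting of the `l`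
occurring an odd number of times in `ls` (`W_{l⁺}² = 1`, the `W_{l⁺}` commute) —
`⟨W_{l⁺}⟩ ≅ (ℤ/2ℤ)^{#\{l ∣ N⁺\}}`. [cite: BertoliniDarmon1996, §2.3 Lemma 2.5 (proof)] -/
theorem exists_nodup_atkinLehnerPlusList_eq {c : ℕ} {x : GrossSpace S.D K} (hx : x ∈ grossPoints K S c) :
    ∀ (n : ℕ) (l : List ℕ), l.length ≤ n → (∀ q ∈ l, q.Prime ∧ ¬ q ∣ Nminus) →
      ∃ l' : List ℕ, l'.Nodup ∧ (∀ q, q ∈ l' ↔ Odd (l.count q)) ∧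
        atkinLehnerPlusList S l x = atkinLehnerPlusList S l' x := by
  intro n
  induction n with
  | zero =>
    intro l hlen _
    obtain rfl : l = [] := List.eq_nil_of_length_eq_zero (Nat.le_zero.mp hlen)
    exact ⟨[], List.nodup_nil, fun q => by simp, rfl⟩
  | succ n ih =>
    intro l hlen hl
    by_cases hnd : l.Nodup
    · refine ⟨l, hnd, fun q => ?_, rfl⟩
      by_cases hq : q ∈ l
      · rw [List.count_eq_one_of_mem hnd hq]; exact ⟨fun _ => odd_one, fun _ => hq⟩
      · rw [List.count_eq_zero_of_not_mem hq]; exact ⟨fun h => absurd h hq, fun h => absurd h (by decide)⟩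
    · -- a repeated prime `q`: `l ~ q :: q :: l₂`
      obtain ⟨q, hq2⟩ : ∃ q, 2 ≤ l.count q := by
        by_contra hcon
        push Not at hcon
        exact hnd (List.nodup_iff_count_le_one.mpr fun a => by have := hcon a; omega)
      have hqmem : q ∈ l := List.count_pos_iff.mp (by omega)
      have hq1 : q ∈ l.erase q := List.count_pos_iff.mp (by rw [List.count_erase_self]; omega)
      have hp : l.Perm (q :: q :: (l.erase q).erase q) :=
        (List.perm_cons_erase hqmem).trans ((List.perm_cons_erase hq1).cons q)
      set l₂ := (l.erase q).erase q with hl₂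
      have hlen₂ : l₂.length ≤ n := by
        have h := hp.length_eq
        simp only [List.length_cons] at h
        omega
      have hl₂' : ∀ q' ∈ l₂, q'.Prime ∧ ¬ q' ∣ Nminus := fun q' h =>
        hl q' (hp.symm.subset (List.mem_cons_of_mem q (List.mem_cons_of_mem q h)))
      haveI : Fact q.Prime := ⟨(hl q hqmem).1⟩
      obtain ⟨l', hnd', hiff, heq⟩ := ih l₂ hlen₂ hl₂'
      refine ⟨l', hnd', fun q' => ?_, ?_⟩
      · rw [hiff, hp.count_eq q']
        by_cases hq' : q' = q
        · subst hq'
          have he : Even (1 + 1) := by decide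
          rw [List.count_cons_self, List.count_cons_self, add_assoc, Nat.odd_add]
          exact ⟨fun h => iff_of_true h he, fun h => h.mpr he⟩
        · rw [List.count_cons_of_ne (Ne.symm hq'), List.count_cons_of_ne (Ne.symm hq')]
      · rw [atkinLehnerPlusList_perm S hp hl x, atkinLehnerPlusList_cons_cons_self S (hl q hqmem).2 l₂ hx, heq]

/-- `W⁺_{ls ++ ls} x = x` on `H_N(K; c)`. [cite: BertoliniDarmon1996, §2.3 Lemma 2.5 (proof)] -/
theorem atkinLehnerPlusList_append_self {l : List ℕ} (hl : ∀ q ∈ l, q.Prime ∧ ¬ q ∣ Nminus) {c : ℕ}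
    {x : GrossSpace S.D K} (hx : x ∈ grossPoints K S c) : atkinLehnerPlusList S (l ++ l) x = x := by
  obtain ⟨l', hnd', hiff, heq⟩ := exists_nodup_atkinLehnerPlusList_eq S hx _ (l ++ l) le_rfl
    (fun q hq => hl q (by simpa using hq))
  have hnil : l' = [] := List.eq_nil_iff_forall_not_mem.mpr fun q hq => by
    have h := (hiff q).mp hq
    rw [List.count_append, ← two_mul] at h
    exact (Nat.not_odd_iff_even.mpr (even_two_mul _)) h
  rw [heq, hnil, atkinLehnerPlusList_nil]

/-- **A plus-word commutes with `W_{q⁻}`** when `q` is not among its primes. [cite: BertoliniDarmon1996, §2.3 Lemma 2.5 (proof)] -/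
theorem atkinLehnerPlusList_atkinLehner_comm {q : ℕ} [Fact q.Prime] {ls : List ℕ}
    (hl : ∀ l ∈ ls, l.Prime ∧ l ≠ q) (x : GrossSpace S.D K) :
    atkinLehnerPlusList S ls (atkinLehner S q x) = atkinLehner S q (atkinLehnerPlusList S ls x) := by
  induction ls generalizing x with
  | nil => rfl
  | cons l ls ih =>
    haveI : Fact l.Prime := ⟨(hl l List.mem_cons_self).1⟩
    rw [atkinLehnerPlusList_cons, atkinLehnerPlusList_cons,
      atkinLehnerPlus_atkinLehner_comm S (hl l List.mem_cons_self).2 x]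
    exact ih (fun l' hl' => hl l' (List.mem_cons_of_mem l hl')) _

/-- **Plus-words and minus-words commute**: `W⁺_{ls} W⁻_{lm} = W⁻_{lm} W⁺_{ls}` when no prime of `ls` is
in `lm` (so BD96's `W = ⟨W_{l⁺}, W_{l⁻}⟩ = W⁺ × W⁻` is commutative). [cite: BertoliniDarmon1996, §2.3 Lemma 2.5 (proof)] -/
theorem atkinLehnerPlusList_atkinLehnerList_comm {ls lm : List ℕ} (hls : ∀ l ∈ ls, l.Prime)
    (hlm : ∀ q ∈ lm, q.Prime) (hne : ∀ l ∈ ls, ∀ q ∈ lm, l ≠ q) (x : GrossSpace S.D K) :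
    atkinLehnerPlusList S ls (atkinLehnerList S lm x) = atkinLehnerList S lm (atkinLehnerPlusList S ls x) := by
  induction lm generalizing x with
  | nil => rfl
  | cons q lm ih =>
    haveI : Fact q.Prime := ⟨hlm q List.mem_cons_self⟩
    rw [atkinLehnerList_cons, atkinLehnerList_cons,
      ih (fun q' hq' => hlm q' (List.mem_cons_of_mem q hq'))
        (fun l hl q' hq' => hne l hl q' (List.mem_cons_of_mem q hq')) (atkinLehner S q x),
      atkinLehnerPlusList_atkinLehner_comm S (fun l hl => ⟨hls l hl, hne l hl q List.mem_cons_self⟩) x]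

end GrossSpace

/-! ### §4 Local data of `I 𝔓_{q_1} ⋯ 𝔓_{q_j} 𝔔_{l_1} ⋯ 𝔔_{l_k}` and the off-orbit theorem for mixed words -/

namespace GrossPointsAtkinLehner

open GrossPointsCount GrossPointTowerExistence

variable {K : Type u} [Field K] [NumberField K] {Nplus Nminus : ℕ} (S : Brandt.XiSetup Nplus Nminus)

/-- `I 𝔓_{q_1} ⋯ 𝔓_{q_k}` is an invertible right `O`-ideal. [cite: VignerasLNM800, Ch. III §5 exercice 5.8] -/
private theorem isInvertibleRightIdeal_mul_minusProd {l : List ℕ} (hl : ∀ q ∈ l, q.Prime ∧ q ∣ Nminus)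
    {I : Submodule ℤ S.D} (hI : IsInvertibleRightIdeal S.O I) :
    IsInvertibleRightIdeal S.O (I * (l.map fun q => normPrimeIdeal S.O q).prod) := by
  induction l generalizing I with
  | nil => rwa [List.map_nil, List.prod_nil, mul_one]
  | cons q l ih =>
    haveI : Fact q.Prime := ⟨(hl q List.mem_cons_self).1⟩
    have hI' : IsInvertibleRightIdeal S.O (I * normPrimeIdeal S.O q) :=
      isInvertibleRightIdeal_mul_normPrimeIdeal
        (S.toEichlerPackage.forall_isUnit_scalarExtension_padic (hl q List.mem_cons_self).2)
        (S.toEichlerPackage.maximalAtP (hl q List.mem_cons_self).2) S.toEichlerPackage.isEichlerOrder.isZOrder hI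
    rw [List.map_cons, List.prod_cons, ← mul_assoc]
    exact ih (fun q' hq' => hl q' (List.mem_cons_of_mem q hq')) hI'

/-- Away from the primes of `lm`: `(I 𝔓_{q_1} ⋯ 𝔓_{q_k})_l = I_l` for `l ∉ lm`. [folklore] -/
private theorem localAt_mul_minusProd_of_not_mem {lm : List ℕ} (hl : ∀ q ∈ lm, q.Prime ∧ q ∣ Nminus)
    {q : ℕ} [hq : Fact q.Prime] (hql : q ∉ lm) {I : Submodule ℤ S.D} (hI : IsInvertibleRightIdeal S.O I) :
    localAt q (I * (lm.map fun q => normPrimeIdeal S.O q).prod) = localAt q I := by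
  induction lm generalizing I with
  | nil => rw [List.map_nil, List.prod_nil, mul_one]
  | cons q' l ih =>
    haveI : Fact q'.Prime := ⟨(hl q' List.mem_cons_self).1⟩
    have hO : IsZOrder S.O := S.toEichlerPackage.isEichlerOrder.isZOrder
    have hI' : IsInvertibleRightIdeal S.O (I * normPrimeIdeal S.O q') :=
      isInvertibleRightIdeal_mul_normPrimeIdeal
        (S.toEichlerPackage.forall_isUnit_scalarExtension_padic (hl q' List.mem_cons_self).2)
        (S.toEichlerPackage.maximalAtP (hl q' List.mem_cons_self).2) hO hI
    have hne : q ≠ q' := fun h => hql (h ▸ List.mem_cons_self)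
    have hstep : localAt q (I * normPrimeIdeal S.O q') = localAt q I :=
      localAt_mul_normPrimeIdeal_of_ne hO hI hq.out hne
    rw [List.map_cons, List.prod_cons, ← mul_assoc,
      ih (fun q'' hq'' => hl q'' (List.mem_cons_of_mem q' hq'')) (fun h => hql (List.mem_cons_of_mem q' h)) hI',
      hstep]

/-- `I 𝔔_{l_1^{e_1}} ⋯ 𝔔_{l_k^{e_k}}` is an invertible right `O`-ideal (`l_i ∤ N⁻`). [cite: VignerasLNM800, Ch. II §2 and Ch. III §5] -/
private theorem isInvertibleRightIdeal_mul_plusProd {ls : List ℕ} (hl : ∀ l ∈ ls, l.Prime ∧ ¬ l ∣ Nminus)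
    {I : Submodule ℤ S.D} (hI : IsInvertibleRightIdeal S.O I) :
    IsInvertibleRightIdeal S.O (I * (ls.map fun l => atkinLehnerIdeal S.O (l ^ Nplus.factorization l)).prod) := by
  induction ls generalizing I with
  | nil => rwa [List.map_nil, List.prod_nil, mul_one]
  | cons q l ih =>
    haveI : Fact q.Prime := ⟨(hl q List.mem_cons_self).1⟩
    have hO : IsZOrder S.O := S.toEichlerPackage.isEichlerOrder.isZOrder
    obtain ⟨Φ, hΦ⟩ := S.exists_isLevelShape_iff S.nplus_ne_zero (hl q List.mem_cons_self).2
    have hI' := isInvertibleRightIdeal_mul_atkinLehnerIdeal Φ hO hΦ (GrossSpace.isUnit_of_ne_zero S) hI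
    rw [List.map_cons, List.prod_cons, ← mul_assoc]
    exact ih (fun q' hq' => hl q' (List.mem_cons_of_mem q hq')) hI'

/-- Away from the primes of `ls`: `(I 𝔔_{l_1^{e_1}} ⋯ 𝔔_{l_k^{e_k}})_q = I_q` for a prime `q ∉ ls`
(`localAt_mul_atkinLehnerIdeal_of_coprime`). [folklore] -/
private theorem localAt_mul_plusProd_of_not_mem {ls : List ℕ} (hl : ∀ l ∈ ls, l.Prime ∧ ¬ l ∣ Nminus)
    {q : ℕ} [hq : Fact q.Prime] (hql : q ∉ ls) {I : Submodule ℤ S.D} (hI : IsInvertibleRightIdeal S.O I) :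
    localAt q (I * (ls.map fun l => atkinLehnerIdeal S.O (l ^ Nplus.factorization l)).prod) = localAt q I := by
  induction ls generalizing I with
  | nil => rw [List.map_nil, List.prod_nil, mul_one]
  | cons q' l ih =>
    haveI hq' : Fact q'.Prime := ⟨(hl q' List.mem_cons_self).1⟩
    have hO : IsZOrder S.O := S.toEichlerPackage.isEichlerOrder.isZOrder
    obtain ⟨Φ, hΦ⟩ := S.exists_isLevelShape_iff S.nplus_ne_zero (hl q' List.mem_cons_self).2
    have hI' := isInvertibleRightIdeal_mul_atkinLehnerIdeal Φ hO hΦ (GrossSpace.isUnit_of_ne_zero S) hI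
    have hne : q ≠ q' := fun h => hql (h ▸ List.mem_cons_self)
    have hcop : (q' ^ Nplus.factorization q').Coprime q :=
      Nat.Coprime.pow_left _ ((Nat.coprime_primes hq'.out hq.out).mpr (Ne.symm hne))
    have hstep : localAt q (I * atkinLehnerIdeal S.O (q' ^ Nplus.factorization q')) = localAt q I :=
      localAt_mul_atkinLehnerIdeal_of_coprime hO (pow_ne_zero _ hq'.out.ne_zero) hI hcop
    rw [List.map_cons, List.prod_cons, ← mul_assoc,
      ih (fun q'' hq'' => hl q'' (List.mem_cons_of_mem q' hq'')) (fun h => hql (List.mem_cons_of_mem q' h)) hI',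
      hstep]

/-- At a prime `q ∈ ls` (no repetition in `ls`): `(I 𝔔_{l_1^{e_1}} ⋯ 𝔔_{l_k^{e_k}})_q = β w O_q` if
`I_q = β O_q`, `w` an Atkin–Lehner generator of `𝔔_{q^e}` (`localAt_mul_atkinLehnerIdeal_self`). [cite: VignerasLNM800, Ch. II §2] -/
private theorem localAt_mul_plusProd_of_mem {ls : List ℕ} (hl : ∀ l ∈ ls, l.Prime ∧ ¬ l ∣ Nminus)
    (hnd : ls.Nodup) {q : ℕ} [hq : Fact q.Prime] (hql : q ∈ ls) {I : Submodule ℤ S.D}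
    (hI : IsInvertibleRightIdeal S.O I) {β : S.Dˣ} (hβ : localAt q I = β • localAt q S.O)
    (Φ : S.D →ₐ[ℚ] Matrix (Fin 2) (Fin 2) ℚ_[q])
    (hΦ : ∀ y : S.D, y ∈ localAt q S.O ↔ IsLevelShape (Nplus.factorization q) (Φ y)) {w : S.Dˣ}
    (hw : (w : S.D) ∈ atkinLehnerIdeal S.O (q ^ Nplus.factorization q))
    (hW : IsALShape (Nplus.factorization q) (Φ (w : S.D)))
    (hdet : ‖(Φ (w : S.D)).det‖ = (q : ℝ) ^ (-(Nplus.factorization q : ℤ))) :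
    localAt q (I * (ls.map fun l => atkinLehnerIdeal S.O (l ^ Nplus.factorization l)).prod) =
      (β * w) • localAt q S.O := by
  induction ls generalizing I with
  | nil => simp at hql
  | cons q' l ih =>
    haveI hq' : Fact q'.Prime := ⟨(hl q' List.mem_cons_self).1⟩
    have hO : IsZOrder S.O := S.toEichlerPackage.isEichlerOrder.isZOrder
    have hl' : ∀ q'' ∈ l, q''.Prime ∧ ¬ q'' ∣ Nminus := fun q'' hq'' => hl q'' (List.mem_cons_of_mem q' hq'')
    obtain ⟨Φ', hΦ'⟩ := S.exists_isLevelShape_iff S.nplus_ne_zero (hl q' List.mem_cons_self).2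
    have hI' := isInvertibleRightIdeal_mul_atkinLehnerIdeal Φ' hO hΦ' (GrossSpace.isUnit_of_ne_zero S) hI
    obtain ⟨hq'l, hnd'⟩ := List.nodup_cons.mp hnd
    rw [List.map_cons, List.prod_cons, ← mul_assoc]
    by_cases hqq : q = q'
    · subst hqq
      rw [localAt_mul_plusProd_of_not_mem S hl' hq'l hI',
        localAt_mul_atkinLehnerIdeal_self Φ hO hΦ hβ hw hW hdet]
    · have hql' : q ∈ l := (List.mem_cons.mp hql).resolve_left hqq
      have hcop : (q' ^ Nplus.factorization q').Coprime q :=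
        Nat.Coprime.pow_left _ ((Nat.coprime_primes hq'.out hq.out).mpr (Ne.symm hqq))
      have hstep : localAt q (I * atkinLehnerIdeal S.O (q' ^ Nplus.factorization q')) = β • localAt q S.O :=
        (localAt_mul_atkinLehnerIdeal_of_coprime hO (pow_ne_zero _ hq'.out.ne_zero) hI hcop).trans hβ
      exact ih hl' hnd' hql' hI' hstep

variable (h2 : finrank ℚ K = 2) (b : Basis (Fin 2) ℤ (𝓞 K)) (hb : b 0 = 1) (f : K →ₐ[ℚ] S.D)

include hb in
/-- **No word `W⁺_{ls} W⁻_{lm}` with a non-trivial plus part maps a Gross point into its own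
`Pic(𝒪_c)`-orbit** (BD96: `Pic(O) × W` acts simply transitively, `W = ⟨W_{l⁺}, W_{l⁻}⟩`; here the
freeness for words containing some `W_{l⁺}`): for a list `ls` without repetition of primes not dividing
`N⁻` containing a prime `l ∣ N⁺` with `l ∤ c d_K`, and any list `lm` of primes dividing `N⁻`,
`σ • [(f, I)] ≠ W⁺_{ls} (W⁻_{lm} [(f, I)])` for all `σ`. Same argument at `l` as for one prime
(`picard_smul_mk_ne_mk_of_localAt_eq_level`): the other factors `𝔓_q`, `𝔔_{l'}` (`q, l' ≠ l`) do not
change the localisation at `l`, so `(I ∏𝔓_q ∏𝔔_{l'})_l = β w O_l`. [cite: BertoliniDarmon1996, §2.3 Lemma 2.4 and proof of Lemma 2.5] [cite: VignerasLNM800, Ch. II §2] -/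
theorem picard_smul_ne_atkinLehnerPlusList_atkinLehnerList {c : ℕ} [NeZero c] {ls lm : List ℕ}
    (hls : ∀ l ∈ ls, l.Prime ∧ ¬ l ∣ Nminus) (hnd : ls.Nodup) (hlm : ∀ q ∈ lm, q.Prime ∧ q ∣ Nminus)
    {l : ℕ} [hl : Fact l.Prime] (hll : l ∈ ls) (hlN : l ∣ Nplus) (hlc : ¬ l ∣ c)
    (hld : ¬ (l : ℤ) ∣ NumberField.discr K)
    {I : Submodule ℤ S.D} (hr : (⟨f, I⟩ : GrossRep S.D K).IsHeegner S.O c) (σ : ClassGroup (quadOrder K c)) :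
    σ • GrossSpace.mk (⟨f, I⟩ : GrossRep S.D K) ≠
      GrossSpace.atkinLehnerPlusList S ls (GrossSpace.atkinLehnerList S lm (GrossSpace.mk ⟨f, I⟩)) := by
  have hD := GrossSpace.isUnit_of_ne_zero S
  have hO : IsZOrder S.O := S.toEichlerPackage.isEichlerOrder.isZOrder
  have hlm' : ¬ l ∣ Nminus := (hls l hll).2
  have he : 1 ≤ Nplus.factorization l := hl.out.factorization_pos_of_dvd S.nplus_ne_zero hlN
  obtain ⟨Φ, hΦ⟩ := S.exists_isLevelShape_iff S.nplus_ne_zero hlm'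
  obtain ⟨w, hw, hW, hdet⟩ := exists_atkinLehner_generator Φ hO hΦ hD
  have hI : IsInvertibleRightIdeal S.O I := isInvertibleRightIdeal_of_mem_rightIdeals hr.1
  obtain ⟨β, hβI, hβ⟩ := hI.exists_localAt_eq_units_smul hD hO l
  have hIP : IsInvertibleRightIdeal S.O (I * (lm.map fun q => normPrimeIdeal S.O q).prod) :=
    isInvertibleRightIdeal_mul_minusProd S hlm hI
  have hlP : l ∉ lm := fun h => hlm' (hlm l h).2
  have hβP : localAt l (I * (lm.map fun q => normPrimeIdeal S.O q).prod) = β • localAt l S.O :=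
    (localAt_mul_minusProd_of_not_mem S hlm hlP hI).trans hβ
  have hJ := isInvertibleRightIdeal_mul_plusProd S hls hIP
  obtain ⟨β', hβ'J, hβ'⟩ := hJ.exists_localAt_eq_units_smul hD hO l
  have hJw := localAt_mul_plusProd_of_mem S hls hnd hll hIP hβP Φ hΦ hw hW hdet
  rw [GrossSpace.atkinLehnerList_mk, GrossSpace.atkinLehnerPlusList_mk]
  exact picard_smul_mk_ne_mk_of_localAt_eq_level S b hb f hlc hld he Φ hΦ hW hdet hr hβI hβ hβ'J hβ'
    hJw σ

include hb in
/-- **`W⁺_{ls} W⁻_{lm} x ∉ Pic(𝒪_c) • x`** for every Gross point `x` of conductor `c` (any representative),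
`ls ∋ l` as in `picard_smul_ne_atkinLehnerPlusList_atkinLehnerList`. [cite: BertoliniDarmon1996, §2.3 Lemma 2.4 and proof of Lemma 2.5] -/
theorem picard_smul_ne_atkinLehnerPlusList_atkinLehnerList_of_mem {c : ℕ} [NeZero c] {ls lm : List ℕ}
    (hls : ∀ l ∈ ls, l.Prime ∧ ¬ l ∣ Nminus) (hnd : ls.Nodup) (hlm : ∀ q ∈ lm, q.Prime ∧ q ∣ Nminus)
    {l : ℕ} [Fact l.Prime] (hll : l ∈ ls) (hlN : l ∣ Nplus) (hlc : ¬ l ∣ c)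
    (hld : ¬ (l : ℤ) ∣ NumberField.discr K) {x : GrossSpace S.D K} (hx : x ∈ grossPoints K S c)
    (σ : ClassGroup (quadOrder K c)) :
    σ • x ≠ GrossSpace.atkinLehnerPlusList S ls (GrossSpace.atkinLehnerList S lm x) := by
  obtain ⟨r, rfl, hr⟩ := hx
  obtain ⟨f', I⟩ := r
  exact picard_smul_ne_atkinLehnerPlusList_atkinLehnerList S b hb f' hls hnd hlm hll hlN hlc hld hr σ

end GrossPointsAtkinLehner

/-! ### §5 `Pic(𝒪_c) × W⁺ × W⁻` acts freely on `H_N(K; c)`, simply transitively for `K` imaginary quadratic -/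

namespace GrossPointsAtkinLehner

open GrossPointsCount GrossPointTowerExistence

section Free

variable {K : Type u} [Field K] [NumberField K] {Nplus Nminus : ℕ} (S : Brandt.XiSetup Nplus Nminus)

/-- For `T ⊆ {l ∣ N⁺}` (`gcd(N⁺, N⁻) = 1`), the entries of `T.toList` are primes not dividing `N⁻`. [folklore] -/
private theorem forall_mem_toList_plus (hNN : Nplus.Coprime Nminus) {T : Finset ℕ}
    (hT : T ∈ Nplus.primeFactors.powerset) : ∀ l ∈ T.toList, l.Prime ∧ ¬ l ∣ Nminus := fun l hl => by
  have h := Nat.mem_primeFactors.mp (Finset.mem_powerset.mp hT (Finset.mem_toList.mp hl))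
  exact ⟨h.1, fun hlm => h.1.one_lt.ne' (Nat.eq_one_of_dvd_coprimes hNN h.2.1 hlm)⟩

/-- For `T ⊆ {q ∣ N⁻}`, the entries of `T.toList` are primes dividing `N⁻`. [folklore] -/
private theorem forall_mem_toList_minus {T : Finset ℕ} (hT : T ∈ Nminus.primeFactors.powerset) :
    ∀ q ∈ T.toList, q.Prime ∧ q ∣ Nminus := fun q hq => by
  have h := Nat.mem_primeFactors.mp (Finset.mem_powerset.mp hT (Finset.mem_toList.mp hq))
  exact ⟨h.1, h.2.1⟩

/-- Two finite sets of naturals whose concatenated lists have only even multiplicities are equal. [folklore] -/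
private theorem finset_eq_of_forall_not_odd_count {T T' : Finset ℕ}
    (h : ∀ q, ¬ Odd ((T'.toList ++ T.toList).count q)) : T = T' := by
  ext q
  have hq := h q
  rw [List.count_append] at hq
  by_cases h1q : q ∈ T <;> by_cases h2q : q ∈ T'
  · exact iff_of_true h1q h2q
  · rw [List.count_eq_zero_of_not_mem (mt Finset.mem_toList.mp h2q),
      List.count_eq_one_of_mem (Finset.nodup_toList T) (Finset.mem_toList.mpr h1q)] at hq
    exact absurd odd_one hq
  · rw [List.count_eq_one_of_mem (Finset.nodup_toList T') (Finset.mem_toList.mpr h2q),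
      List.count_eq_zero_of_not_mem (mt Finset.mem_toList.mp h1q)] at hq
    exact absurd odd_one hq
  · exact iff_of_false h1q h2q

/-- The translates `σ • W⁺_{T⁺} W⁻_{T⁻} x`, `T^± ⊆ {l ∣ N^±}`, of a Gross point are Gross points of the same
conductor. [cite: BertoliniDarmon1996, §2.3 (4) and Lemma 2.5 (proof)] -/
theorem picard_smul_atkinLehnerLists_mem (hNN : Nplus.Coprime Nminus) {c : ℕ} [NeZero c]
    {x : GrossSpace S.D K} (hx : x ∈ grossPoints K S c)
    (p : ClassGroup (quadOrder K c) × ↥(Nplus.primeFactors.powerset) ×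
      ↥(Nminus.primeFactors.powerset)) :
    p.1 • GrossSpace.atkinLehnerPlusList S p.2.1.1.toList (GrossSpace.atkinLehnerList S p.2.2.1.toList x) ∈
      grossPoints K S c :=
  picard_smul_mem_grossPoints (GrossSpace.atkinLehnerPlusList_mem_grossPoints S
    (forall_mem_toList_plus hNN p.2.1.2)
    (GrossSpace.atkinLehnerList_mem_grossPoints S (forall_mem_toList_minus p.2.2.2) hx)) p.1

/-- **`Pic(𝒪_c) × W` acts freely on `H_N(K; c)`**, `W = W⁺ × W⁻ = ⟨W_{l⁺} : l ∣ N⁺⟩ × ⟨W_{q⁻} : q ∣ N⁻⟩ ≅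
(ℤ/2ℤ)^t` (BD96, proof of Lemma 2.5: "the group `Pic(O) × W` acts simply transitively on the set
`H_N(K; c)`" — the freeness half, for general `(N⁺, N⁻)`): for `K` quadratic, `gcd(N⁺, N⁻) = 1`, `N⁺ N⁻`
prime to `c d_K`, all primes of `N⁻` inert in `K`, and any Gross point `x` of conductor `c`, the map
`(σ, T⁺, T⁻) ↦ σ • W⁺_{T⁺} W⁻_{T⁻} x` (`σ ∈ Pic(𝒪_c)`, `T^± ⊆ {l ∣ N^±}`, words `T.toList`) is injective
on `Pic(𝒪_c) × 𝒫({l ∣ N⁺}) × 𝒫({q ∣ N⁻})`. No splitting hypothesis at the primes of `N⁺` is needed.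
Proof: an equality gives, after applying `W⁺_{T⁺}` and `W⁻_{T⁻}` (`W² = 1`, all the involutions commute,
§3 and the ramified file §6), `σ • x = τ • W⁺_{L⁺} W⁻_{L⁻} x` with square-free words `L^±` for
`T^± △ T'^±`; `L⁺ = ∅` by §4, then `L⁻ = ∅` by the ramified file §5, then `σ = τ` by freeness of
`Pic(𝒪_c)`. [cite: BertoliniDarmon1996, §2.3 Lemma 2.4 and proof of Lemma 2.5] -/
theorem picard_atkinLehnerSets_injective (h2 : finrank ℚ K = 2) (hNN : Nplus.Coprime Nminus)
    (hcop : (Nplus * Nminus).Coprime (NumberField.discr K).natAbs)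
    (hinert : ∀ ℓ : ℕ, ℓ.Prime → ℓ ∣ Nminus → ((Ideal.span {(ℓ : ℤ)}).primesOver (𝓞 K)).ncard = 1)
    {c : ℕ} [NeZero c] (hcN : c.Coprime (Nplus * Nminus)) {x : GrossSpace S.D K}
    (hx : x ∈ grossPoints K S c) :
    Function.Injective fun p : ClassGroup (quadOrder K c) × ↥(Nplus.primeFactors.powerset) ×
        ↥(Nminus.primeFactors.powerset) =>
      p.1 • GrossSpace.atkinLehnerPlusList S p.2.1.1.toList (GrossSpace.atkinLehnerList S p.2.2.1.toList x) := by
  classical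
  obtain ⟨b, hb⟩ := exists_basis_zero_eq_one h2
  rintro ⟨σ, ⟨T, hT⟩, ⟨U, hU⟩⟩ ⟨τ, ⟨T', hT'⟩, ⟨U', hU'⟩⟩ h0
  replace h0 : σ • GrossSpace.atkinLehnerPlusList S T.toList (GrossSpace.atkinLehnerList S U.toList x) =
      τ • GrossSpace.atkinLehnerPlusList S T'.toList (GrossSpace.atkinLehnerList S U'.toList x) := h0
  have hlT := forall_mem_toList_plus (Nplus := Nplus) hNN hT
  have hlT' := forall_mem_toList_plus (Nplus := Nplus) hNN hT'
  have hlU := forall_mem_toList_minus (Nminus := Nminus) hU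
  have hlU' := forall_mem_toList_minus (Nminus := Nminus) hU'
  have hy : GrossSpace.atkinLehnerList S U.toList x ∈ grossPoints K S c :=
    GrossSpace.atkinLehnerList_mem_grossPoints S hlU hx
  have hy' : GrossSpace.atkinLehnerList S U'.toList x ∈ grossPoints K S c :=
    GrossSpace.atkinLehnerList_mem_grossPoints S hlU' hx
  -- apply `W⁺_{T}` to both sides
  have h1 := congrArg (GrossSpace.atkinLehnerPlusList S T.toList) h0
  rw [← GrossSpace.picard_smul_atkinLehnerPlusList S hlT (GrossSpace.atkinLehnerPlusList_mem_grossPoints S hlT hy) σ,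
    ← GrossSpace.picard_smul_atkinLehnerPlusList S hlT (GrossSpace.atkinLehnerPlusList_mem_grossPoints S hlT' hy') τ,
    ← GrossSpace.atkinLehnerPlusList_append, ← GrossSpace.atkinLehnerPlusList_append,
    GrossSpace.atkinLehnerPlusList_append_self S hlT hy] at h1
  -- apply `W⁻_{U}` to both sides and move it inside
  have hlTT : ∀ q ∈ T'.toList ++ T.toList, q.Prime ∧ ¬ q ∣ Nminus := fun q hq => by
    rcases List.mem_append.mp hq with h | h
    · exact hlT' q h
    · exact hlT q h
  have hz : GrossSpace.atkinLehnerPlusList S (T'.toList ++ T.toList) (GrossSpace.atkinLehnerList S U'.toList x) ∈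
      grossPoints K S c := GrossSpace.atkinLehnerPlusList_mem_grossPoints S hlTT hy'
  have h3 := congrArg (GrossSpace.atkinLehnerList S U.toList) h1
  rw [← GrossSpace.picard_smul_atkinLehnerList S hlU hy σ, ← GrossSpace.atkinLehnerList_append,
    GrossSpace.atkinLehnerList_append_self S hlU hx, ← GrossSpace.picard_smul_atkinLehnerList S hlU hz τ,
    ← GrossSpace.atkinLehnerPlusList_atkinLehnerList_comm S (fun l hl => (hlTT l hl).1) (fun q hq => (hlU q hq).1)
      (fun l hl q hq hlq => (hlTT l hl).2 (hlq ▸ (hlU q hq).2)),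
    ← GrossSpace.atkinLehnerList_append] at h3
  -- `h3 : σ • x = τ • W⁺_{T' ++ T} (W⁻_{U' ++ U} x)`; reduce both words to square-free ones
  have hlUU : ∀ q ∈ U'.toList ++ U.toList, q.Prime ∧ q ∣ Nminus := fun q hq => by
    rcases List.mem_append.mp hq with h | h
    · exact hlU' q h
    · exact hlU q h
  obtain ⟨lm, hndm, hiffm, heqm⟩ :=
    GrossSpace.exists_nodup_atkinLehnerList_eq S hx _ (U'.toList ++ U.toList) le_rfl hlUU
  rw [heqm] at h3
  have hlm : ∀ q ∈ lm, q.Prime ∧ q ∣ Nminus := fun q hq =>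
    hlUU q (List.count_pos_iff.mp (Nat.pos_of_ne_zero fun h0 => by
      have h := (hiffm q).mp hq; rw [h0] at h; exact (by decide : ¬ Odd 0) h))
  have hxm : GrossSpace.atkinLehnerList S lm x ∈ grossPoints K S c :=
    GrossSpace.atkinLehnerList_mem_grossPoints S hlm hx
  obtain ⟨lp, hndp, hiffp, heqp⟩ :=
    GrossSpace.exists_nodup_atkinLehnerPlusList_eq S hxm _ (T'.toList ++ T.toList) le_rfl hlTT
  rw [heqp] at h3
  have hlp : ∀ l ∈ lp, l.Prime ∧ ¬ l ∣ Nminus := fun l hl =>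
    hlTT l (List.count_pos_iff.mp (Nat.pos_of_ne_zero fun h0 => by
      have h := (hiffp l).mp hl; rw [h0] at h; exact (by decide : ¬ Odd 0) h))
  have hlpN : ∀ l ∈ lp, l ∣ Nplus := fun l hl => by
    have hl' : l ∈ T'.toList ++ T.toList := List.count_pos_iff.mp (Nat.pos_of_ne_zero fun h0 => by
      have h := (hiffp l).mp hl; rw [h0] at h; exact (by decide : ¬ Odd 0) h)
    rcases List.mem_append.mp hl' with h | h
    · exact (Nat.mem_primeFactors.mp (Finset.mem_powerset.mp hT' (Finset.mem_toList.mp h))).2.1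
    · exact (Nat.mem_primeFactors.mp (Finset.mem_powerset.mp hT (Finset.mem_toList.mp h))).2.1
  -- the reduced plus word is empty
  have hnilp : lp = [] := by
    by_contra hne
    obtain ⟨l, hll⟩ := List.exists_mem_of_ne_nil lp hne
    haveI : Fact l.Prime := ⟨(hlp l hll).1⟩
    have hlN : l ∣ Nplus := hlpN l hll
    have hlc : ¬ l ∣ c := fun h =>
      (hlp l hll).1.one_lt.ne' (Nat.eq_one_of_dvd_coprimes hcN h (Dvd.dvd.mul_right hlN Nminus))
    have hld : ¬ (l : ℤ) ∣ NumberField.discr K := fun h =>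
      (hlp l hll).1.one_lt.ne' (Nat.eq_one_of_dvd_coprimes hcop (Dvd.dvd.mul_right hlN Nminus)
        (Int.natCast_dvd.mp h))
    apply picard_smul_ne_atkinLehnerPlusList_atkinLehnerList_of_mem S b hb hlp hndp hlm hll hlN hlc hld hx
      (τ⁻¹ * σ)
    rw [mul_smul, h3, ← mul_smul, inv_mul_cancel, one_smul]
  rw [hnilp, GrossSpace.atkinLehnerPlusList_nil] at h3
  -- the reduced minus word is empty
  have hnilm : lm = [] := by
    by_contra hne
    obtain ⟨q, hql⟩ := List.exists_mem_of_ne_nil lm hne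
    haveI : Fact q.Prime := ⟨(hlm q hql).1⟩
    have hqN : q ∣ Nminus := (hlm q hql).2
    have hqc : ¬ q ∣ c := fun h =>
      (hlm q hql).1.one_lt.ne' (Nat.eq_one_of_dvd_coprimes hcN h (Dvd.dvd.mul_left hqN Nplus))
    have hqd : ¬ (q : ℤ) ∣ NumberField.discr K := fun h =>
      (hlm q hql).1.one_lt.ne' (Nat.eq_one_of_dvd_coprimes hcop (Dvd.dvd.mul_left hqN Nplus)
        (Int.natCast_dvd.mp h))
    apply picard_smul_ne_atkinLehnerList_of_mem S h2 b hb hlm hndm hql hqc hqd (hinert q (hlm q hql).1 hqN)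
      hx (τ⁻¹ * σ)
    rw [mul_smul, h3, ← mul_smul, inv_mul_cancel, one_smul]
  rw [hnilm, GrossSpace.atkinLehnerList_nil] at h3
  -- hence `σ = τ`, `T = T'`, `U = U'`
  have hστ : σ = τ := GrossSpace.picard_smul_left_injective S h2 hx h3
  have hTT : T = T' := finset_eq_of_forall_not_odd_count fun q => by
    rw [← hiffp q, hnilp]; exact List.not_mem_nil
  have hUU : U = U' := finset_eq_of_forall_not_odd_count fun q => by
    rw [← hiffm q, hnilm]; exact List.not_mem_nil
  subst hστ; subst hTT; subst hUU; rfl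

end Free

section SimplyTransitive

variable {K : Type} [Field K] [NumberField K] {Nplus Nminus : ℕ} (S : Brandt.XiSetup Nplus Nminus)

/-- **Bertolini–Darmon 1996, proof of Lemma 2.5: `Pic(𝒪_c) × W` acts simply transitively on
`H_N(K; c)`**, `W = ⟨W_{l⁺}, W_{q⁻} : l ∣ N⁺, q ∣ N⁻⟩ ≅ (ℤ/2ℤ)^t`, `t = #\{p ∣ N\}`, for a general type
`(N⁺, N⁻)`. Precisely: for `K` imaginary quadratic, `N = N⁺ N⁻` square-free and prime to `c d_K` with the
primes of `N⁺` split and those of `N⁻` inert in `K`, and ANY Gross point `x ∈ H_N(K; c)` on the curve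
attached to an Eichler order of level `N⁺` in the definite quaternion algebra of discriminant `N⁻`, the
map `(σ, T⁺, T⁻) ↦ σ • W⁺_{T⁺} W⁻_{T⁻} x` (`σ ∈ Pic(𝒪_c)`, `T^± ⊆ {p ∣ N^±}`, `W_T = ∏_{p ∈ T} W_p` as
the word `T.toList`) is a bijection `Pic(𝒪_c) × 𝒫({l ∣ N⁺}) × 𝒫({q ∣ N⁻}) → H_N(K; c)`: injective by
`picard_atkinLehnerSets_injective`, bijective since both sides have `2^t · #Pic(𝒪_c)` elements
(`GrossPointsCount.natCard_grossPoints_eq_two_pow_mul_natCard_classGroup`, BD96 Lemma 2.5 (1)). In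
particular "the orbits of Heegner points under the action of `Pic(O)`" are the `2^t` translates of one
orbit by `W`. [cite: BertoliniDarmon1996, §2.3 Lemma 2.5 (1) and its proof] -/
theorem picard_atkinLehnerSets_bijective (hK : IsImaginaryQuadratic K) (hsqf : Squarefree (Nplus * Nminus))
    (hcop : (Nplus * Nminus).Coprime (NumberField.discr K).natAbs)
    (hsplit : ∀ ℓ : ℕ, ℓ.Prime → ℓ ∣ Nplus → ((Ideal.span {(ℓ : ℤ)}).primesOver (𝓞 K)).ncard = 2)
    (hinert : ∀ ℓ : ℕ, ℓ.Prime → ℓ ∣ Nminus → ((Ideal.span {(ℓ : ℤ)}).primesOver (𝓞 K)).ncard = 1)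
    {c : ℕ} [NeZero c] (hcN : c.Coprime (Nplus * Nminus)) {x : GrossSpace S.D K}
    (hx : x ∈ grossPoints K S c) :
    Function.Bijective fun p : ClassGroup (quadOrder K c) × ↥(Nplus.primeFactors.powerset) ×
        ↥(Nminus.primeFactors.powerset) =>
      (⟨p.1 • GrossSpace.atkinLehnerPlusList S p.2.1.1.toList (GrossSpace.atkinLehnerList S p.2.2.1.toList x),
        picard_smul_atkinLehnerLists_mem S (Nat.coprime_of_squarefree_mul hsqf) hx p⟩ : grossPoints K S c) := by
  classical
  haveI := GrossSpace.finite_coe_grossPoints S hK.1 c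
  have hNN : Nplus.Coprime Nminus := Nat.coprime_of_squarefree_mul hsqf
  have hinj : Function.Injective fun p : ClassGroup (quadOrder K c) ×
      ↥(Nplus.primeFactors.powerset) × ↥(Nminus.primeFactors.powerset) =>
      (⟨p.1 • GrossSpace.atkinLehnerPlusList S p.2.1.1.toList (GrossSpace.atkinLehnerList S p.2.2.1.toList x),
        picard_smul_atkinLehnerLists_mem S (Nat.coprime_of_squarefree_mul hsqf) hx p⟩ : grossPoints K S c) :=
    fun p p' h => picard_atkinLehnerSets_injective S hK.1 hNN hcop hinert hcN hx (congrArg Subtype.val h)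
  refine hinj.bijective_of_nat_card_le (le_of_eq ?_)
  rw [natCard_grossPoints_eq_two_pow_mul_natCard_classGroup S hK hsqf hcop hsplit hinert c hcN,
    Nat.card_prod, Nat.card_prod, Nat.card_eq_finsetCard, Nat.card_eq_finsetCard, Finset.card_powerset,
    Finset.card_powerset, hNN.primeFactors_mul, Finset.card_union_of_disjoint hNN.disjoint_primeFactors,
    pow_add]
  ring

end SimplyTransitive

end GrossPointsAtkinLehner

end Literature.NumberTheory.EllipticCurves

end
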